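import Mathlib.MeasureTheory.Function.Jacobian
import Literature.ModelTheory.ExponentialFields.SemialgebraicC1TriangulationProofs
import Literature.ModelTheory.ExponentialFields.SemialgebraicSimplex
import HarnessLib

/-!
# Dimension of semialgebraic sets (van den Dries, *Tame topology*, Ch. 4 §1)

The o-minimal dimension theory of [Dries1998, Ch. 4, (1.1)–(1.8)], specialised to semialgebraic
subsets of `ℝⁿ` and built on the cylindrical decomposition of `CylindricalDecomposition.lean`:

* `IsSACell k n d C` — `C ⊆ ℝⁿ` is a semialgebraic `(i₁, …, iₙ)`-cell with `i₁ + ⋯ + iₙ = d`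
  (the CAD vocabulary `graphOver` / `bandOver` of `CylindricalDecomposition.lean`; the
  first-order o-minimal notion `IsCell L m ι C` of `OMinimalCells.lean` is the analogue for
  `L`-structures) (graphs and bands
  over cells, by the recursion of Def. 5.1 of [BasuPollackRoy2006]; [Dries1998, Ch. 3 (2.3)]);
  every cell of a cylindrical decomposition is a cell (`IsCylindricalDecomposition.exists_isSACell`);
* `IsSACell.exists_chart` — the coordinate projection `p_C` of a `d`-cell onto its band coordinates
  is a homeomorphism onto an open cell of `ℝᵈ` with continuous semialgebraic inverse
  [Dries1998, Ch. 3 (2.7)];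
* `sdim S` — the dimension: the largest `d` such that some coordinate projection of `S` to `ℝᵈ`
  has nonempty interior ([Dries1998, Ch. 4 (1.1)] defines it as the largest dimension of a cell
  contained in `S`; the two agree for semialgebraic sets: `IsSACell.sdim_eq`,
  `IsSACell.le_sdim_of_subset`, `sdim_sUnion_cells_le`);
* `interior_image_eq_empty_of_lt` — the image of an open semialgebraic `U ⊆ ℝᵈ` under a continuous
  semialgebraic map into `ℝᵉ`, `e > d`, has empty interior (smooth part Lebesgue-null via
  `IsSemialgebraicFunOn.exists_contDiffOn_holds` and
  `MeasureTheory.addHaar_image_eq_zero_of_differentiableOn_of_addHaar_eq_zero`; singular part by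
  induction through the charts of the cells of an adapted decomposition) — this replaces the
  combinatorial Lemma (1.2) of loc. cit.;
* `IsSACell.sdim_eq` (cells have their construction dimension, (1.4)), `sdim_mono`, `sdim_union`
  ((1.3)(iii)), `sdim_closure` ((1.8), second assertion), `sdim_image_le` (`dim f(X) ≤ dim X`,
  (1.6)(ii)), `sdim_image_eq_of_inverse` (invariance under semialgebraic homeomorphisms,
  (1.3)(ii)).

* `fibre`, `projFirst`, `IsCylindricalDecomposition.exists_base_fibres` (a decomposition of
  `ℝ^{m+n}` is the `n`-fold stack over one of `ℝᵐ`; `dim C = dim πC + dim C_a`, (1.5) proof /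
  Ch. 3 (3.5)(i)) and `sdim_fibre_formula` — **the fibre dimension formula** (1.5): `S(d)` is
  semialgebraic and the part of `S` above it has dimension `dim S(d) + d`.

* `finite_setOf_frontier_fibre_ne` — **Lemma (1.7)**: for semialgebraic `A ⊆ ℝ × ℝᵖ`, the
  frontier of the fibre `A_x` is the fibre of the frontier for all but finitely many `x`;
* `sdim_lt_of_fibres` (fibrewise domination of dimension) and `sdim_closure_diff_lt` — **the
  frontier inequality (1.8)**: `cl S ∖ S = ∅ ∨ dim (cl S ∖ S) < dim S`; with the by-products
  `finite_of_sdim_eq_zero`, `sdim_eq_zero_of_finite`, `sdim_image_equivComp`;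
* `sdim_inter_closure_diff_lt` ((1.9)), `IsSACell.exists_isOpen_eq_inter` ((1.14): a cell inside
  a cell of the same dimension is open in it), `exists_cells_isOpen_in` ((1.15)),
  `IsSAStratification` ((1.11)) and `exists_stratification` — **existence of stratifications
  (1.13)**: a closed semialgebraic set has a stratification (finite partition into cells with the
  frontier condition) partitioning finitely many given semialgebraic sets.

## References

* [Dries1998] L. van den Dries, *Tame Topology and O-minimal Structures*, LMS LNS 248 (1998),
  Ch. 3 §2, Ch. 4 §1 (PDF pp. 80–83 of the held copy, read).
* [BasuPollackRoy2006] S. Basu, R. Pollack, M.-F. Roy, *Algorithms in Real Algebraic Geometry*,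
  Def. 5.1, §5.3.
-/

noncomputable section

open Set Filter
open _root_.Topology
open scoped ContDiff

namespace Literature.ModelTheory.ExponentialFields

open Literature.NumberTheory.Transcendental (IsSemialgebraicFunOn IsSemialgebraicMapOn
  isSemialgebraicFunOn_iff)

/-- The distance between two points of `ℝⁿ⁺¹` differing only in the last coordinate
(a copy of `dist_snoc_snoc` from the triangulation file, which is not imported here). [folklore] -/
theorem dist_snoc_snoc' {n : ℕ} (x : Fin n → ℝ) (a b : ℝ) :
    dist (Fin.snoc x a : Fin (n + 1) → ℝ) (Fin.snoc x b) = dist a b := by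
  apply le_antisymm
  · refine (dist_pi_le_iff dist_nonneg).mpr fun i => ?_
    refine Fin.lastCases ?_ (fun j => ?_) i
    · simp
    · simp
  · have h := dist_le_pi_dist (Fin.snoc x a : Fin (n + 1) → ℝ) (Fin.snoc x b) (Fin.last n)
    simpa using h

/-! ## Cells -/

section Cells

variable (k : Type*) [CommRing k] [Algebra k ℝ]

/-- **Cells** [Dries1998, Ch. 3 (2.3)]; [BasuPollackRoy2006, Def. 5.1]: `IsSACell k n d C` says that
`C ⊆ ℝⁿ` is a cell of dimension `d` built by the cylindrical recursion — the point `ℝ⁰`; the graph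
over a `d`-cell of a continuous `k`-semialgebraic function (dimension `d`); a band between two
consecutive sections of a strictly increasing finite family of continuous `k`-semialgebraic
functions over a `d`-cell, or below the first / above the last / the whole cylinder
(dimension `d + 1`). [cite: Dries1998, Ch. 3 (2.3)] -/
inductive IsSACell : (n d : ℕ) → Set (Fin n → ℝ) → Prop
  | zero : IsSACell 0 0 univ
  | graph {n d : ℕ} {S : Set (Fin n → ℝ)} {f : (Fin n → ℝ) → ℝ} :
      IsSACell n d S → ContinuousOn f S → IsSemialgebraicFunOn k S f → IsSACell (n + 1) d (graphOver S f)
  | band {n d l : ℕ} {S : Set (Fin n → ℝ)} {ξ : Fin l → (Fin n → ℝ) → ℝ} (j : Fin (l + 1)) :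
      IsSACell n d S → (∀ i, ContinuousOn (ξ i) S) → (∀ i, IsSemialgebraicFunOn k S (ξ i)) →
      (∀ x ∈ S, StrictMono fun i => ξ i x) → IsSACell (n + 1) (d + 1) (bandOver S ξ j)

variable {k}

/-- Cells have dimension at most the ambient dimension. [cite: Dries1998, Ch. 3 (2.3)] -/
theorem IsSACell.le {n d : ℕ} {C : Set (Fin n → ℝ)} (h : IsSACell k n d C) : d ≤ n := by
  induction h with
  | zero => exact le_rfl
  | graph _ _ _ ih => exact ih.trans (Nat.le_succ _)
  | band _ _ _ _ _ ih => exact Nat.succ_le_succ ih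

/-- Cells are nonempty. [cite: Dries1998, Ch. 3 (2.3)] -/
theorem IsSACell.nonempty {n d : ℕ} {C : Set (Fin n → ℝ)} (h : IsSACell k n d C) : C.Nonempty := by
  induction h with
  | zero => exact univ_nonempty
  | @graph n d S f _ _ _ ih =>
    obtain ⟨x, hx⟩ := ih
    exact ⟨Fin.snoc x (f x), by simp [hx]⟩
  | @band n d l S ξ j _ hc _ hm ih =>
    obtain ⟨x, hx⟩ := ih
    obtain ⟨m, -, hm'⟩ := exists_continuousOn_snoc_mem_bandOver hc hm j
    exact ⟨_, hm' x hx⟩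

/-- The projection forgetting the last coordinate is an open map (it has continuous sections
through every point). [folklore] -/
theorem isOpenMap_init {n : ℕ} : IsOpenMap (fun z : Fin (n + 1) → ℝ => Fin.init z) := by
  rw [isOpenMap_iff_nhds_le]
  intro z
  have hs : Continuous fun y : Fin n → ℝ => (Fin.snoc y (z (Fin.last n)) : Fin (n + 1) → ℝ) := by
    refine continuous_pi fun i => ?_
    refine Fin.lastCases ?_ (fun j => ?_) i
    · simp only [Fin.snoc_last]
      exact continuous_const
    · simp only [Fin.snoc_castSucc]
      exact continuous_apply j
  have h1 : map (fun y : Fin n → ℝ => (Fin.snoc y (z (Fin.last n)) : Fin (n + 1) → ℝ))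
      (𝓝 (Fin.init z)) ≤ 𝓝 z := by
    have h := hs.tendsto (Fin.init z)
    rwa [Fin.snoc_init_self] at h
  calc 𝓝 (Fin.init z)
      = map (fun z : Fin (n + 1) → ℝ => Fin.init z)
          (map (fun y : Fin n → ℝ => (Fin.snoc y (z (Fin.last n)) : Fin (n + 1) → ℝ))
            (𝓝 (Fin.init z))) := by
        rw [Filter.map_map]
        have : ((fun z : Fin (n + 1) → ℝ => Fin.init z) ∘ fun y : Fin n → ℝ =>
            (Fin.snoc y (z (Fin.last n)) : Fin (n + 1) → ℝ)) = id := by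
          funext y
          simp
        rw [this, Filter.map_id]
    _ ≤ map (fun z : Fin (n + 1) → ℝ => Fin.init z) (𝓝 z) := Filter.map_mono h1

/-- A band over an open set, cut out by sections continuous on it, is open.
[cite: BasuPollackRoy2006, Def. 5.1] -/
theorem isOpen_bandOver {n l : ℕ} {S : Set (Fin n → ℝ)} (hS : IsOpen S)
    {ξ : Fin l → (Fin n → ℝ) → ℝ} (hξ : ∀ i, ContinuousOn (ξ i) S) (j : Fin (l + 1)) :
    IsOpen (bandOver S ξ j) := by
  have hV : IsOpen {z : Fin (n + 1) → ℝ | Fin.init z ∈ S} :=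
    hS.preimage continuous_id.finInit
  have hlast : Continuous fun z : Fin (n + 1) → ℝ => z (Fin.last n) := continuous_apply _
  have hsec : ∀ i, ContinuousOn (fun z : Fin (n + 1) → ℝ => ξ i (Fin.init z))
      {z : Fin (n + 1) → ℝ | Fin.init z ∈ S} := fun i =>
    (hξ i).comp continuous_id.finInit.continuousOn fun z hz => hz
  -- lower bound
  have hlow : IsOpen {z : Fin (n + 1) → ℝ | Fin.init z ∈ S ∧
      bandLower ξ j (Fin.init z) < (z (Fin.last n) : EReal)} := by
    by_cases h0 : j = 0
    · subst h0
      convert hV using 1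
      ext z
      simp
    · have hset : {z : Fin (n + 1) → ℝ | Fin.init z ∈ S ∧
          bandLower ξ j (Fin.init z) < (z (Fin.last n) : EReal)} =
          {z : Fin (n + 1) → ℝ | Fin.init z ∈ S} ∩
            (fun z => z (Fin.last n) - ξ (j.pred h0) (Fin.init z)) ⁻¹' Ioi 0 := by
        ext z
        simp only [mem_setOf_eq, mem_inter_iff, mem_preimage, mem_Ioi, bandLower_of_ne_zero ξ j h0,
          EReal.coe_lt_coe_iff, sub_pos]
      rw [hset]
      exact (hlast.continuousOn.sub (hsec _)).isOpen_inter_preimage hV isOpen_Ioi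
  have hup : IsOpen {z : Fin (n + 1) → ℝ | Fin.init z ∈ S ∧
      (z (Fin.last n) : EReal) < bandUpper ξ j (Fin.init z)} := by
    by_cases hl : j = Fin.last l
    · subst hl
      convert hV using 1
      ext z
      simp
    · have hset : {z : Fin (n + 1) → ℝ | Fin.init z ∈ S ∧
          (z (Fin.last n) : EReal) < bandUpper ξ j (Fin.init z)} =
          {z : Fin (n + 1) → ℝ | Fin.init z ∈ S} ∩
            (fun z => ξ (j.castPred hl) (Fin.init z) - z (Fin.last n)) ⁻¹' Ioi 0 := by
        ext z
        simp only [mem_setOf_eq, mem_inter_iff, mem_preimage, mem_Ioi, bandUpper_of_ne_last ξ j hl,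
          EReal.coe_lt_coe_iff, sub_pos]
      rw [hset]
      exact ((hsec _).sub hlast.continuousOn).isOpen_inter_preimage hV isOpen_Ioi
  have hset : bandOver S ξ j = {z : Fin (n + 1) → ℝ | Fin.init z ∈ S ∧
      bandLower ξ j (Fin.init z) < (z (Fin.last n) : EReal)} ∩
      {z | Fin.init z ∈ S ∧ (z (Fin.last n) : EReal) < bandUpper ξ j (Fin.init z)} := by
    ext z
    simp only [mem_bandOver_iff, mem_inter_iff, mem_setOf_eq]
    tauto
  rw [hset]
  exact hlow.inter hup

/-- A band over a `k`-semialgebraic set cut out by `k`-semialgebraic sections is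
`k`-semialgebraic. [cite: BasuPollackRoy2006, Def. 5.1] -/
theorem isSemialgebraic_bandOver' {n l : ℕ} {S : Set (Fin n → ℝ)} (hS : IsSemialgebraic k S)
    {ξ : Fin l → (Fin n → ℝ) → ℝ} (hξ : ∀ i, IsSemialgebraicFunOn k S (ξ i)) (j : Fin (l + 1)) :
    IsSemialgebraic k (bandOver S ξ j) := by
  have hV : IsSemialgebraic k {z : Fin (n + 1) → ℝ | Fin.init z ∈ S} := hS.setOf_init_mem
  have hlow : IsSemialgebraic k {z : Fin (n + 1) → ℝ | Fin.init z ∈ S ∧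
      bandLower ξ j (Fin.init z) < (z (Fin.last n) : EReal)} := by
    by_cases h0 : j = 0
    · subst h0
      convert hV using 1
      ext z
      simp
    · have h := (hξ (j.pred h0)).isSemialgebraic_setOf_le tarski_seidenberg_real_holds
      convert hV.diff h using 1
      ext z
      simp only [mem_setOf_eq, Set.mem_sdiff, bandLower_of_ne_zero ξ j h0, EReal.coe_lt_coe_iff]
      constructor
      · rintro ⟨hz, hlt⟩
        exact ⟨hz, fun h' => absurd h'.2 (not_le.mpr hlt)⟩
      · rintro ⟨hz, hn⟩
        exact ⟨hz, not_le.mp fun hle => hn ⟨hz, hle⟩⟩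
  have hup : IsSemialgebraic k {z : Fin (n + 1) → ℝ | Fin.init z ∈ S ∧
      (z (Fin.last n) : EReal) < bandUpper ξ j (Fin.init z)} := by
    by_cases hl : j = Fin.last l
    · subst hl
      convert hV using 1
      ext z
      simp
    · have h := (hξ (j.castPred hl)).isSemialgebraic_setOf_ge tarski_seidenberg_real_holds
      convert hV.diff h using 1
      ext z
      simp only [mem_setOf_eq, Set.mem_sdiff, bandUpper_of_ne_last ξ j hl, EReal.coe_lt_coe_iff]
      constructor
      · rintro ⟨hz, hlt⟩
        exact ⟨hz, fun h' => absurd h'.2 (not_le.mpr hlt)⟩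
      · rintro ⟨hz, hn⟩
        exact ⟨hz, not_le.mp fun hle => hn ⟨hz, hle⟩⟩
  have hset : bandOver S ξ j = {z : Fin (n + 1) → ℝ | Fin.init z ∈ S ∧
      bandLower ξ j (Fin.init z) < (z (Fin.last n) : EReal)} ∩
      {z | Fin.init z ∈ S ∧ (z (Fin.last n) : EReal) < bandUpper ξ j (Fin.init z)} := by
    ext z
    simp only [mem_bandOver_iff, mem_inter_iff, mem_setOf_eq]
    tauto
  rw [hset]
  exact hlow.inter hup

/-- Cells are `k`-semialgebraic. [cite: Dries1998, Ch. 3 (2.3)] -/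
theorem IsSACell.isSemialgebraic {n d : ℕ} {C : Set (Fin n → ℝ)} (h : IsSACell k n d C) :
    IsSemialgebraic k C := by
  induction h with
  | zero => exact isSemialgebraic_univ
  | @graph n d S f _ _ hs ih =>
    exact isSemialgebraicFunOn_iff_isSemialgebraic_graphOver.mp hs
  | @band n d l S ξ j _ hc hs hm ih =>
    exact isSemialgebraic_bandOver' ih hs j

/-- Graphs have empty interior. [folklore] -/
theorem interior_graphOver_eq_empty {n : ℕ} (S : Set (Fin n → ℝ)) (f : (Fin n → ℝ) → ℝ) :
    interior (graphOver S f) = ∅ := by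
  refine eq_empty_of_forall_notMem fun z hz => ?_
  obtain ⟨ε, hε, hball⟩ := Metric.isOpen_iff.mp isOpen_interior z hz
  have h1 : (Fin.snoc (Fin.init z) (z (Fin.last n) + ε / 2) : Fin (n + 1) → ℝ) ∈ graphOver S f := by
    refine interior_subset (hball ?_)
    rw [Metric.mem_ball]
    have h := dist_snoc_snoc' (Fin.init z) (z (Fin.last n) + ε / 2) (z (Fin.last n))
    rw [Fin.snoc_init_self] at h
    rw [h, Real.dist_eq, show z (Fin.last n) + ε / 2 - z (Fin.last n) = ε / 2 by ring,
      abs_of_pos (half_pos hε)]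
    exact half_lt_self hε
  have h2 : z ∈ graphOver S f := interior_subset hz
  rw [mem_graphOver_iff] at h2
  rw [snoc_mem_graphOver_iff] at h1
  linarith [h1.2, h2.2]

/-- **Open cells**: a cell of full dimension is open. [cite: Dries1998, Ch. 3 (2.4)] -/
theorem IsSACell.isOpen {n d : ℕ} {C : Set (Fin n → ℝ)} (h : IsSACell k n d C) (hd : d = n) :
    IsOpen C := by
  induction h with
  | zero => exact isOpen_univ
  | graph h _ _ _ =>
    have := h.le
    omega
  | band j _ hc _ _ ih =>
    exact isOpen_bandOver (ih (by omega)) hc j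

/-- **Thin cells**: a cell of dimension `< n` has empty interior. [cite: Dries1998, Ch. 3 (2.4)] -/
theorem IsSACell.interior_eq_empty {n d : ℕ} {C : Set (Fin n → ℝ)} (h : IsSACell k n d C)
    (hd : d < n) : interior C = ∅ := by
  induction h with
  | zero => omega
  | @graph n d S f _ _ _ _ => exact interior_graphOver_eq_empty S f
  | @band n d l S ξ j _ _ _ _ ih =>
    have hS : interior S = ∅ := ih (by omega)
    refine subset_empty_iff.mp ?_
    have hsub : bandOver S ξ j ⊆ (fun z : Fin (n + 1) → ℝ => Fin.init z) ⁻¹' S := fun z hz => hz.1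
    calc interior (bandOver S ξ j) ⊆ interior ((fun z : Fin (n + 1) → ℝ => Fin.init z) ⁻¹' S) :=
          interior_mono hsub
      _ ⊆ (fun z : Fin (n + 1) → ℝ => Fin.init z) ⁻¹' interior S :=
          isOpenMap_init.interior_preimage_subset_preimage_interior
      _ = ∅ := by rw [hS, preimage_empty]

/-- The dimension of a cell is `n` iff the cell has nonempty interior.
[cite: Dries1998, Ch. 4 (1.1)] -/
theorem IsSACell.interior_nonempty_iff {n d : ℕ} {C : Set (Fin n → ℝ)} (h : IsSACell k n d C) :
    (interior C).Nonempty ↔ d = n := by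
  constructor
  · intro hne
    by_contra hne'
    have := h.interior_eq_empty (lt_of_le_of_ne h.le hne')
    rw [this] at hne
    exact not_nonempty_empty hne
  · intro hd
    rw [(h.isOpen hd).interior_eq]
    exact h.nonempty

/-- `k`-cells are real cells. [folklore] -/
theorem IsSACell.real {n d : ℕ} {C : Set (Fin n → ℝ)} (h : IsSACell k n d C) : IsSACell ℝ n d C := by
  induction h with
  | zero => exact IsSACell.zero
  | graph _ hc hs ih => exact ih.graph hc hs.real_of
  | band j _ hc hs hm ih => exact IsSACell.band j ih hc (fun i => (hs i).real_of) hm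

/-- Appending the empty tuple. [folklore] -/
theorem _root_.Fin.append_elim0' {m : ℕ} {α : Type*} (u : Fin m → α) :
    Fin.append u (Fin.elim0 : Fin 0 → α) = u := by
  rw [Fin.append_elim0]
  rfl

/-- **The cells of a cylindrical decomposition are cells.** [cite: Dries1998, Ch. 3 (2.10)]
[cite: BasuPollackRoy2006, Def. 5.1] -/
theorem IsCylindricalDecomposition.exists_isSACell :
    ∀ {n : ℕ} {𝒮 : Finset (Set (Fin n → ℝ))}, IsCylindricalDecomposition k n 𝒮 →
      ∀ C ∈ 𝒮, ∃ d, IsSACell k n d C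
  | 0, 𝒮, h, C, hC => by
    have h' : 𝒮 = {univ} := h
    subst h'
    rw [Finset.mem_singleton] at hC
    subst hC
    exact ⟨0, IsSACell.zero⟩
  | n + 1, 𝒯, h, C, hC => by
    obtain ⟨𝒮, h𝒮, l, ξ, hcont, hsa, hmono, hmem⟩ := h.2.2
    obtain ⟨S, hS, hCS⟩ := (hmem C).mp hC
    obtain ⟨d, hd⟩ := IsCylindricalDecomposition.exists_isSACell h𝒮 S hS
    rcases hCS with ⟨j, rfl⟩ | ⟨j, rfl⟩
    · exact ⟨d, hd.graph (hcont S hS j) (hsa S hS j)⟩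
    · exact ⟨d + 1, IsSACell.band j hd (hcont S hS) (hsa S hS) (hmono S hS)⟩

end Cells

/-! ## Charts of cells [Dries1998, Ch. 3 (2.7)] -/

section Charts

variable {k : Type*} [CommRing k] [Algebra k ℝ]

/-- The coordinate selection of a band: the old band coordinates, then the new last coordinate.
[folklore] -/
theorem comp_snocIdx {n d : ℕ} (ι : Fin d → Fin n) (z : Fin (n + 1) → ℝ) :
    (z ∘ (Fin.snoc (fun i => Fin.castSucc (ι i)) (Fin.last n) : Fin (d + 1) → Fin (n + 1))) =
      Fin.snoc (Fin.init z ∘ ι) (z (Fin.last n)) := by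
  funext l
  refine Fin.lastCases ?_ (fun i => ?_) l
  · simp
  · simp [Fin.init]

/-- The coordinate selection of a graph: the old band coordinates. [folklore] -/
theorem comp_castSuccIdx {n d : ℕ} (ι : Fin d → Fin n) (z : Fin (n + 1) → ℝ) :
    (z ∘ fun i => Fin.castSucc (ι i)) = Fin.init z ∘ ι := by
  funext i
  simp [Fin.init]

/-- The extended coordinate selection is strictly increasing. [folklore] -/
theorem strictMono_snocIdx {n d : ℕ} {ι : Fin d → Fin n} (hι : StrictMono ι) :
    StrictMono (Fin.snoc (fun i => Fin.castSucc (ι i)) (Fin.last n) : Fin (d + 1) → Fin (n + 1)) := by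
  intro a b hab
  induction b using Fin.lastCases with
  | last =>
    induction a using Fin.lastCases with
    | last => exact absurd hab (lt_irrefl _)
    | cast a' => simp [Fin.castSucc_lt_last (ι a')]
  | cast b' =>
    induction a using Fin.lastCases with
    | last => exact absurd hab (not_lt.mpr (Fin.le_last _))
    | cast a' =>
      have h : a' < b' := Fin.castSucc_lt_castSucc_iff.mp hab
      simpa using hι h

/-- Lower band boundary of composed sections. [folklore] -/
theorem bandLower_comp {n d l : ℕ} (ξ : Fin l → (Fin n → ℝ) → ℝ) (φ : (Fin d → ℝ) → (Fin n → ℝ))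
    (j : Fin (l + 1)) (u : Fin d → ℝ) :
    bandLower (fun i => ξ i ∘ φ) j u = bandLower ξ j (φ u) := by
  induction j using Fin.cases with
  | zero => simp
  | succ i => simp

/-- Upper band boundary of composed sections. [folklore] -/
theorem bandUpper_comp {n d l : ℕ} (ξ : Fin l → (Fin n → ℝ) → ℝ) (φ : (Fin d → ℝ) → (Fin n → ℝ))
    (j : Fin (l + 1)) (u : Fin d → ℝ) :
    bandUpper (fun i => ξ i ∘ φ) j u = bandUpper ξ j (φ u) := by
  induction j using Fin.lastCases with
  | last => simp
  | cast i => simp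

/-- **Charts of cells** [Dries1998, Ch. 3 (2.7)]: a `d`-cell `C ⊆ ℝⁿ` has `d` band coordinates
`ι` such that the projection `p_C : x ↦ x ∘ ι` is a bijection of `C` onto an OPEN `d`-cell
`U ⊆ ℝᵈ` whose inverse `φ` is continuous and `k`-semialgebraic on `U`.
[cite: Dries1998, Ch. 3 (2.7)] -/
theorem IsSACell.exists_chart {n d : ℕ} {C : Set (Fin n → ℝ)} (h : IsSACell k n d C) :
    ∃ (ι : Fin d → Fin n) (U : Set (Fin d → ℝ)) (φ : (Fin d → ℝ) → (Fin n → ℝ)),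
      StrictMono ι ∧ IsSACell k d d U ∧ U = (fun x : Fin n → ℝ => x ∘ ι) '' C ∧
      ContinuousOn φ U ∧ IsSemialgebraicMapOn k U φ ∧
      (∀ x ∈ C, φ (x ∘ ι) = x) ∧ (∀ u ∈ U, φ u ∈ C ∧ (φ u) ∘ ι = u) := by
  induction h with
  | zero =>
    refine ⟨fun i => i, univ, id, fun a _ _ => a.elim0, IsSACell.zero, ?_, continuousOn_id,
      Literature.NumberTheory.Transcendental.isSemialgebraicMapOn_id isSemialgebraic_univ,
      fun x _ => Subsingleton.elim _ _, fun u _ => ⟨mem_univ _, Subsingleton.elim _ _⟩⟩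
    ext u
    exact ⟨fun _ => ⟨u, mem_univ _, Subsingleton.elim _ _⟩, fun _ => mem_univ _⟩
  | @graph n d S f hS hfc hfs ih =>
    obtain ⟨ι, U, φ, hι, hU, hUeq, hφc, hφs, hleft, hright⟩ := ih
    have hUs : IsSemialgebraic k U := hU.isSemialgebraic
    have hφS : MapsTo φ U S := fun u hu => (hright u hu).1
    refine ⟨fun i => Fin.castSucc (ι i), U, fun u => Fin.snoc (φ u) (f (φ u)),
      fun a b hab => by simpa using hι hab, hU, ?_, ?_, ?_, ?_, ?_⟩
    · -- U = image
      rw [hUeq]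
      ext u
      constructor
      · rintro ⟨x, hx, rfl⟩
        refine ⟨Fin.snoc x (f x), ⟨by simpa using hx, by simp⟩, ?_⟩
        beta_reduce
        rw [comp_castSuccIdx, Fin.init_snoc]
      · rintro ⟨z, hz, rfl⟩
        refine ⟨Fin.init z, hz.1, ?_⟩
        beta_reduce
        rw [comp_castSuccIdx]
    · -- continuity
      have h1 : ContinuousOn φ U := hφc
      have h2 : ContinuousOn (fun u => f (φ u)) U := hfc.comp hφc hφS
      exact h1.finSnoc h2
    · -- semialgebraicity
      refine IsSemialgebraicMapOn.of_forall hUs fun l => ?_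
      refine Fin.lastCases ?_ (fun i => ?_) l
      · simp only [Fin.snoc_last]
        exact IsSemialgebraicFunOn.comp_isSemialgebraicMapOn_holds hfs hφs hφS
      · simp only [Fin.snoc_castSucc]
        exact (Literature.NumberTheory.Transcendental.isSemialgebraicMapOn_iff_forall_holds hUs).mp
          hφs i
    · -- left inverse
      intro z hz
      beta_reduce
      rw [comp_castSuccIdx, hleft _ hz.1, ← hz.2, Fin.snoc_init_self]
    · -- right inverse
      intro u hu
      refine ⟨⟨by simpa using hφS hu, by simp⟩, ?_⟩
      beta_reduce
      rw [comp_castSuccIdx, Fin.init_snoc, (hright u hu).2]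
  | @band n d l S ξ j hS hξc hξs hmono ih =>
    obtain ⟨ι, U, φ, hι, hU, hUeq, hφc, hφs, hleft, hright⟩ := ih
    have hUs : IsSemialgebraic k U := hU.isSemialgebraic
    have hφS : MapsTo φ U S := fun u hu => (hright u hu).1
    set ι' : Fin (d + 1) → Fin (n + 1) := Fin.snoc (fun i => Fin.castSucc (ι i)) (Fin.last n) with hι'
    set U' : Set (Fin (d + 1) → ℝ) := bandOver U (fun i => ξ i ∘ φ) j with hU'
    have hξφc : ∀ i, ContinuousOn (ξ i ∘ φ) U := fun i => (hξc i).comp hφc hφS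
    have hξφs : ∀ i, IsSemialgebraicFunOn k U (ξ i ∘ φ) := fun i =>
      IsSemialgebraicFunOn.comp_isSemialgebraicMapOn_holds (hξs i) hφs hφS
    have hU'cell : IsSACell k (d + 1) (d + 1) U' :=
      IsSACell.band j hU hξφc hξφs fun u hu => hmono _ (hφS hu)
    have hU's : IsSemialgebraic k U' := hU'cell.isSemialgebraic
    have hinit : ∀ w ∈ U', Fin.init w ∈ U := fun w hw => hw.1
    refine ⟨ι', U', fun w => Fin.snoc (φ (Fin.init w)) (w (Fin.last d)), strictMono_snocIdx hι,
      hU'cell, ?_, ?_, ?_, ?_, ?_⟩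
    · -- U' = image
      ext w
      constructor
      · intro hw
        obtain ⟨hwU, hlo, hup⟩ := hw
        obtain ⟨hxS, hxι⟩ := hright _ hwU
        refine ⟨Fin.snoc (φ (Fin.init w)) (w (Fin.last d)), ⟨by simpa using hxS, ?_, ?_⟩, ?_⟩
        · simpa [bandLower_comp] using hlo
        · simpa [bandUpper_comp] using hup
        · beta_reduce
          rw [comp_snocIdx, Fin.init_snoc, Fin.snoc_last, hxι, Fin.snoc_init_self]
      · rintro ⟨z, hz, rfl⟩
        obtain ⟨hzS, hlo, hup⟩ := hz
        beta_reduce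
        rw [comp_snocIdx]
        refine ⟨?_, ?_, ?_⟩
        · show Fin.init (Fin.snoc (Fin.init z ∘ ι) (z (Fin.last n)) : Fin (d + 1) → ℝ) ∈ U
          rw [Fin.init_snoc, hUeq]
          exact ⟨Fin.init z, hzS, rfl⟩
        · simp only [Fin.init_snoc, Fin.snoc_last, bandLower_comp, hleft _ hzS]
          exact hlo
        · simp only [Fin.init_snoc, Fin.snoc_last, bandUpper_comp, hleft _ hzS]
          exact hup
    · -- continuity
      have h1 : ContinuousOn (fun w : Fin (d + 1) → ℝ => φ (Fin.init w)) U' :=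
        hφc.comp continuous_id.finInit.continuousOn hinit
      have h2 : ContinuousOn (fun w : Fin (d + 1) → ℝ => w (Fin.last d)) U' :=
        (continuous_apply _).continuousOn
      exact h1.finSnoc h2
    · -- semialgebraicity
      refine IsSemialgebraicMapOn.of_forall hU's fun l' => ?_
      refine Fin.lastCases ?_ (fun i => ?_) l'
      · simp only [Fin.snoc_last]
        exact isSemialgebraicFunOn_apply hU's (Fin.last d)
      · simp only [Fin.snoc_castSucc]
        have hφi : IsSemialgebraicFunOn k U (fun u => φ u i) :=
          (Literature.NumberTheory.Transcendental.isSemialgebraicMapOn_iff_forall_holds hUs).mp hφs i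
        exact hφi.comp_init.mono hinit hU's
    · -- left inverse
      intro z hz
      have hzS : Fin.init z ∈ S := hz.1
      beta_reduce
      rw [comp_snocIdx, Fin.init_snoc, Fin.snoc_last, hleft _ hzS, Fin.snoc_init_self]
    · -- right inverse
      intro w hw
      obtain ⟨hwU, hlo, hup⟩ := hw
      obtain ⟨hxS, hxι⟩ := hright _ hwU
      refine ⟨⟨by simpa using hxS, ?_, ?_⟩, ?_⟩
      · simpa [bandLower_comp] using hlo
      · simpa [bandUpper_comp] using hup
      · beta_reduce
        rw [comp_snocIdx, Fin.init_snoc, Fin.snoc_last, hxι, Fin.snoc_init_self]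

end Charts

/-- Real linear maps are semialgebraic maps (a copy of `LinearMap.isSemialgebraicMapOn'` of the
triangulation file, which is not imported here). [cite: BochnakCosteRoy1998, §2.2] -/
theorem LinearMap.isSemialgebraicMapOn'' {m l : ℕ} (M : (Fin m → ℝ) →ₗ[ℝ] (Fin l → ℝ))
    {s : Set (Fin m → ℝ)} (hs : IsSemialgebraic ℝ s) : IsSemialgebraicMapOn ℝ s M := by
  refine (Literature.NumberTheory.Transcendental.isSemialgebraicMapOn_aeval hs
    (fun j => affinePoly ((LinearMap.proj j : (Fin l → ℝ) →ₗ[ℝ] ℝ).comp M) 0)).congr fun x _ => ?_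
  funext j
  show MvPolynomial.aeval x (affinePoly ((LinearMap.proj j : (Fin l → ℝ) →ₗ[ℝ] ℝ).comp M) 0) = M x j
  rw [aeval_affinePoly, add_zero]
  rfl

/-! ## Dimension [Dries1998, Ch. 4 (1.1)] -/

section Dimension

open MeasureTheory

variable {n : ℕ}

/-- **Dimension of a subset of `ℝⁿ`** (intended for semialgebraic sets): the largest `d` such that
the projection of `S` to some `d` coordinates has nonempty interior in `ℝᵈ`; `0` for the empty
set.  For semialgebraic `S` this is van den Dries' dimension (the largest dimension of a cell
contained in `S`): `IsSACell.sdim_eq`, `sdim_sUnion_cells_le`. [cite: Dries1998, Ch. 4 (1.1)] -/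
def sdim (S : Set (Fin n → ℝ)) : ℕ :=
  sSup {d | ∃ ι : Fin d → Fin n, Function.Injective ι ∧
    (interior ((fun x : Fin n → ℝ => x ∘ ι) '' S)).Nonempty}

/-- An injection `Fin d → Fin n` forces `d ≤ n`. [folklore] -/
theorem card_le_of_injective_fin {d : ℕ} {ι : Fin d → Fin n}
    (hι : Function.Injective ι) : d ≤ n := by
  simpa using Fintype.card_le_of_injective ι hι

/-- The set of witnessed dimensions is bounded by `n`. [folklore] -/
theorem bddAbove_sdimSet (S : Set (Fin n → ℝ)) :
    BddAbove {d | ∃ ι : Fin d → Fin n, Function.Injective ι ∧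
      (interior ((fun x : Fin n → ℝ => x ∘ ι) '' S)).Nonempty} :=
  ⟨n, fun _ ⟨_, hι, _⟩ => card_le_of_injective_fin hι⟩

/-- `sdim S ≤ n`. [cite: Dries1998, Ch. 4 (1.1)] -/
theorem sdim_le (S : Set (Fin n → ℝ)) : sdim S ≤ n :=
  csSup_le' fun _ ⟨_, hι, _⟩ => card_le_of_injective_fin hι

/-- A coordinate projection with nonempty interior bounds the dimension below.
[cite: Dries1998, Ch. 4 (1.1)] -/
theorem le_sdim {S : Set (Fin n → ℝ)} {d : ℕ} {ι : Fin d → Fin n} (hι : Function.Injective ι)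
    (h : (interior ((fun x : Fin n → ℝ => x ∘ ι) '' S)).Nonempty) : d ≤ sdim S :=
  le_csSup (bddAbove_sdimSet S) ⟨ι, hι, h⟩

/-- The dimension of a nonempty set is attained by some coordinate projection.
[cite: Dries1998, Ch. 4 (1.1)] -/
theorem exists_sdim_witness {S : Set (Fin n → ℝ)} (hS : S.Nonempty) :
    ∃ ι : Fin (sdim S) → Fin n, Function.Injective ι ∧
      (interior ((fun x : Fin n → ℝ => x ∘ ι) '' S)).Nonempty := by
  have h0 : (0 : ℕ) ∈ {d | ∃ ι : Fin d → Fin n, Function.Injective ι ∧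
      (interior ((fun x : Fin n → ℝ => x ∘ ι) '' S)).Nonempty} := by
    refine ⟨Fin.elim0, fun a => a.elim0, ?_⟩
    obtain ⟨x, hx⟩ := hS
    have : (fun x : Fin n → ℝ => x ∘ (Fin.elim0 : Fin 0 → Fin n)) '' S = univ :=
      eq_univ_of_forall fun u => ⟨x, hx, Subsingleton.elim _ _⟩
    rw [this, interior_univ]
    exact univ_nonempty
  have hmem := Nat.sSup_mem ⟨0, h0⟩ (bddAbove_sdimSet S)
  exact hmem

/-- Monotonicity. [cite: Dries1998, Ch. 4 (1.3)(i)] -/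
theorem sdim_mono {S T : Set (Fin n → ℝ)} (h : S ⊆ T) : sdim S ≤ sdim T :=
  csSup_le' fun _ ⟨_, hι, hne⟩ => le_sdim hι (hne.mono (interior_mono (image_mono h)))

/-- A set with nonempty interior has full dimension. [cite: Dries1998, Ch. 4 (1.1)] -/
theorem sdim_eq_of_interior_nonempty {S : Set (Fin n → ℝ)} (h : (interior S).Nonempty) :
    sdim S = n := by
  refine le_antisymm (sdim_le S) (le_sdim (ι := id) Function.injective_id ?_)
  have : (fun x : Fin n → ℝ => x ∘ id) '' S = S := by simp
  rw [this]
  exact h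

/-- The empty set has dimension `0` (convention). [cite: Dries1998, Ch. 4 (1.1)] -/
theorem sdim_empty : sdim (∅ : Set (Fin n → ℝ)) = 0 := by
  apply Nat.eq_zero_of_le_zero
  refine csSup_le' fun d ⟨ι, _, hne⟩ => ?_
  simp at hne

/-- Reindexing along a bijection of coordinates preserves nonempty interiors. [folklore] -/
theorem interior_nonempty_of_proj {S : Set (Fin n → ℝ)} {d : ℕ} (hd : d = n) (ι : Fin d → Fin n)
    (hι : Function.Injective ι) (hne : (interior ((fun x : Fin n → ℝ => x ∘ ι) '' S)).Nonempty) :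
    (interior S).Nonempty := by
  subst hd
  have hbij : Function.Bijective ι := Finite.injective_iff_bijective.mp hι
  set σ : Fin d ≃ Fin d := Equiv.ofBijective ι hbij with hσ
  let L : (Fin d → ℝ) ≃L[ℝ] (Fin d → ℝ) :=
    (LinearEquiv.funCongrLeft ℝ ℝ σ).toContinuousLinearEquiv
  have hL : ∀ x : Fin d → ℝ, L x = x ∘ ι := fun x => rfl
  have himg : (fun x : Fin d → ℝ => x ∘ ι) '' S = L.toHomeomorph '' S :=
    image_congr fun x _ => (hL x).symm
  rw [himg, ← L.toHomeomorph.image_interior] at hne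
  exact (image_nonempty.mp hne)

/-- Full dimension means nonempty interior (for nonempty sets). [cite: Dries1998, Ch. 4 (1.1)] -/
theorem interior_nonempty_of_sdim_eq {S : Set (Fin n → ℝ)} (hS : S.Nonempty) (h : sdim S = n) :
    (interior S).Nonempty := by
  obtain ⟨ι, hι, hne⟩ := exists_sdim_witness hS
  exact interior_nonempty_of_proj h ι hι hne

/-! ### Semialgebraic maps do not raise dimension: images in higher dimension are thin -/

/-- Two semialgebraic sets with empty interior have a union with empty interior (both are
nowhere dense). [cite: BochnakCosteRoy1998, Prop. 2.8.13] -/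
theorem IsSemialgebraic.interior_union_eq_empty {S T : Set (Fin n → ℝ)} (hS : IsSemialgebraic ℝ S)
    (hT : IsSemialgebraic ℝ T) (hS0 : interior S = ∅) (hT0 : interior T = ∅) :
    interior (S ∪ T) = ∅ := by
  refine subset_empty_iff.mp ?_
  calc interior (S ∪ T) ⊆ interior (closure S ∪ closure T) :=
        interior_mono (union_subset_union subset_closure subset_closure)
    _ = interior (closure S) :=
        interior_union_isClosed_of_interior_empty isClosed_closure (hT.interior_closure_eq_empty hT0)
    _ = ∅ := hS.interior_closure_eq_empty hS0

/-- Finite unions of semialgebraic sets with empty interior have empty interior.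
[cite: BochnakCosteRoy1998, Prop. 2.8.13] -/
theorem interior_biUnion_eq_empty_of_isSemialgebraic {β : Type*} (I : Finset β)
    (Z : β → Set (Fin n → ℝ)) (hs : ∀ b ∈ I, IsSemialgebraic ℝ (Z b))
    (hi : ∀ b ∈ I, interior (Z b) = ∅) : interior (⋃ b ∈ I, Z b) = ∅ := by
  classical
  induction I using Finset.induction_on with
  | empty => simp
  | insert a I ha ih =>
    rw [Finset.set_biUnion_insert]
    exact (hs a (Finset.mem_insert_self a I)).interior_union_eq_empty
      (IsSemialgebraic.biUnion I _ fun b hb => hs b (Finset.mem_insert_of_mem hb))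
      (hi a (Finset.mem_insert_self a I)) (ih (fun b hb => hs b (Finset.mem_insert_of_mem hb))
        fun b hb => hi b (Finset.mem_insert_of_mem hb))

/-- **Semialgebraic images in higher dimension are thin** [Dries1998, Ch. 4 (1.2)–(1.4), the
content of "`dim f(X) ≤ dim X`"]: the image of an open semialgebraic `U ⊆ ℝᵈ` under a continuous
semialgebraic map into `ℝᵉ`, `e > d`, has empty interior.  Proof (in place of the book's
combinatorial Lemma 1.2): off a nowhere dense semialgebraic `Z` the map is `C^∞`
(`IsSemialgebraicFunOn.exists_contDiffOn_holds`), so that part of the image is Lebesgue-null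
(`MeasureTheory.addHaar_image_eq_zero_of_differentiableOn_of_addHaar_eq_zero`); `Z` is a finite
union of cells of dimension `< d`, whose images are thin by induction through their charts.
[cite: Dries1998, Ch. 4 (1.3)–(1.6)] -/
theorem interior_image_eq_empty_of_lt :
    ∀ (d : ℕ) {e : ℕ}, d < e → ∀ {U : Set (Fin d → ℝ)}, IsOpen U → IsSemialgebraic ℝ U →
      ∀ {F : (Fin d → ℝ) → (Fin e → ℝ)}, ContinuousOn F U → IsSemialgebraicMapOn ℝ U F →
        interior (F '' U) = ∅ := by
  intro d
  induction d using Nat.strong_induction_on with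
  | _ d IH =>
  intro e hde U hUo hUs F hFc hFs
  classical
  -- the smooth locus of the components
  have hcomp : ∀ j, ∃ Z : Set (Fin d → ℝ), Z ⊆ U ∧ IsSemialgebraic ℝ Z ∧ interior Z = ∅ ∧
      IsOpen (U \ Z) ∧ ContDiffOn ℝ ∞ (fun u => F u j) (U \ Z) := fun j =>
    IsSemialgebraicFunOn.exists_contDiffOn_holds (k := ℝ) hUo
      ((Literature.NumberTheory.Transcendental.isSemialgebraicMapOn_iff_forall_holds hUs).mp hFs j)
  choose Z hZU hZs hZint hZopen hZsmooth using hcomp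
  set Zall : Set (Fin d → ℝ) := ⋃ j, Z j with hZall
  have hZall' : Zall = ⋃ j ∈ (Finset.univ : Finset (Fin e)), Z j := by simp [hZall]
  have hZall_s : IsSemialgebraic ℝ Zall := by
    rw [hZall']
    exact IsSemialgebraic.biUnion _ _ fun j _ => hZs j
  have hZall_int : interior Zall = ∅ := by
    rw [hZall']
    exact interior_biUnion_eq_empty_of_isSemialgebraic _ _ (fun j _ => hZs j) fun j _ => hZint j
  have hZallU : Zall ⊆ U := iUnion_subset hZU
  set U' : Set (Fin d → ℝ) := U \ Zall with hU'
  have hU'open : IsOpen U' := by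
    haveI : Nonempty (Fin e) := ⟨⟨0, by omega⟩⟩
    rw [hU', hZall, Set.sdiff_iUnion]
    exact isOpen_iInter_of_finite hZopen
  have hFdiff : DifferentiableOn ℝ F U' := by
    have h : ContDiffOn ℝ ∞ F U' := contDiffOn_pi' fun j =>
      (hZsmooth j).mono (Set.sdiff_subset_sdiff_right (subset_iUnion _ j))
    exact h.differentiableOn (by simp)
  -- (a) the smooth part has a Lebesgue-null image
  have hsmooth : interior (F '' U') = ∅ := by
    let P : (Fin e → ℝ) → (Fin d → ℝ) := fun w i => w (Fin.castLE hde.le i)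
    let Emb : (Fin d → ℝ) → (Fin e → ℝ) := fun u j => if h : (j : ℕ) < d then u ⟨j, h⟩ else 0
    have hPE : ∀ u, P (Emb u) = u := by
      intro u
      funext i
      simp [P, Emb, Fin.castLE]
    have hP : Differentiable ℝ P := differentiable_pi.mpr fun i => differentiable_apply _
    set A : Set (Fin e → ℝ) := Emb '' U' with hA
    have hAsub : A ⊆ (LinearMap.ker (LinearMap.proj (⟨d, hde⟩ : Fin e) : (Fin e → ℝ) →ₗ[ℝ] ℝ) :
        Set (Fin e → ℝ)) := by
      rintro _ ⟨u, -, rfl⟩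
      simp [Emb]
    have hker : LinearMap.ker (LinearMap.proj (⟨d, hde⟩ : Fin e) : (Fin e → ℝ) →ₗ[ℝ] ℝ) ≠ ⊤ := by
      intro htop
      have h1 : (fun _ : Fin e => (1 : ℝ)) ∈
          LinearMap.ker (LinearMap.proj (⟨d, hde⟩ : Fin e) : (Fin e → ℝ) →ₗ[ℝ] ℝ) := by
        rw [htop]
        exact Submodule.mem_top
      simp at h1
    have hA0 : volume A = 0 :=
      measure_mono_null hAsub (Measure.addHaar_submodule volume _ hker)
    have hG : DifferentiableOn ℝ (F ∘ P) (P ⁻¹' U') :=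
      hFdiff.comp hP.differentiableOn (mapsTo_preimage _ _)
    have hAU : A ⊆ P ⁻¹' U' := by
      rintro _ ⟨u, hu, rfl⟩
      show P (Emb u) ∈ U'
      rwa [hPE]
    have himg : (F ∘ P) '' A = F '' U' := by
      rw [hA, image_image]
      exact image_congr fun u _ => by simp [Function.comp, hPE]
    have h0 : volume (F '' U') = 0 := by
      rw [← himg]
      exact addHaar_image_eq_zero_of_differentiableOn_of_addHaar_eq_zero volume (hG.mono hAU) hA0
    by_contra hne
    have hpos := Measure.measure_pos_of_nonempty_interior (μ := volume) (nonempty_iff_ne_empty.mpr hne)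
    rw [h0] at hpos
    exact lt_irrefl _ hpos
  -- (b) the singular part, cell by cell
  obtain ⟨𝒟, h𝒟, hadapt⟩ := IsSemialgebraic.exists_cylindricalDecomposition_holds (k := ℝ)
    ({Zall} : Finset (Set (Fin d → ℝ))) (by simpa using hZall_s)
  obtain ⟨𝒞, h𝒞, hZeq⟩ := hadapt Zall (by simp)
  have hcellimg : ∀ C ∈ 𝒞, interior (F '' C) = ∅ := by
    intro C hC
    have hCZ : C ⊆ Zall := hZeq ▸ subset_sUnion_of_mem hC
    have hCU : C ⊆ U := hCZ.trans hZallU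
    obtain ⟨dC, hcell⟩ := h𝒟.exists_isSACell C (h𝒞 hC)
    have hdC : dC < d := by
      refine lt_of_le_of_ne hcell.le fun h => ?_
      have hne := (hcell.interior_nonempty_iff).mpr h
      have hsub := interior_mono hCZ
      rw [hZall_int] at hsub
      exact not_nonempty_empty (hne.mono hsub)
    obtain ⟨ι, V, φ, -, hV, hVeq, hφc, hφs, hleft, hright⟩ := hcell.exists_chart
    have hφC : MapsTo φ V C := fun v hv => (hright v hv).1
    have hCeq : C = φ '' V := by
      ext x
      constructor
      · intro hx
        exact ⟨x ∘ ι, hVeq ▸ ⟨x, hx, rfl⟩, hleft x hx⟩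
      · rintro ⟨v, hv, rfl⟩
        exact hφC hv
    have hF' : interior ((F ∘ φ) '' V) = ∅ :=
      IH dC hdC (lt_trans hdC hde) (hV.isOpen rfl) (hV.isSemialgebraic)
        (hFc.comp hφc fun v hv => hCU (hφC hv))
        (IsSemialgebraicMapOn.comp_holds (hFs.mono hCU (hcell.isSemialgebraic)) hφs hφC)
    rwa [hCeq, ← image_comp]
  -- assemble: `U = U' ∪ ⋃ 𝒞`, a finite union of semialgebraic pieces with thin images
  have hUeq : U = U' ∪ ⋃ C ∈ 𝒞, C := by
    have h1 : (⋃ C ∈ 𝒞, C) = Zall := by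
      rw [← hZeq, sUnion_eq_biUnion]
      rfl
    rw [h1, hU', Set.sdiff_union_of_subset hZallU]
  rw [hUeq, image_union, image_iUnion₂]
  have hpieces : ∀ C ∈ 𝒞, IsSemialgebraic ℝ (F '' C) := fun C hC =>
    Literature.NumberTheory.Transcendental.IsSemialgebraicMapOn.isSemialgebraic_image_holds hFs
      ((hZeq ▸ subset_sUnion_of_mem hC).trans hZallU) (h𝒟.isSemialgebraic C (h𝒞 hC))
  refine (Literature.NumberTheory.Transcendental.IsSemialgebraicMapOn.isSemialgebraic_image_holds hFs
    Set.sdiff_subset (hUs.diff hZall_s)).interior_union_eq_empty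
    (IsSemialgebraic.biUnion 𝒞 _ hpieces) hsmooth
    (interior_biUnion_eq_empty_of_isSemialgebraic 𝒞 _ hpieces hcellimg)

/-- **Cells have their construction dimension** [Dries1998, Ch. 4 (1.4)]: `sdim C = d` for a
`d`-cell `C`. [cite: Dries1998, Ch. 4 (1.4)] -/
theorem IsSACell.sdim_eq {d : ℕ} {C : Set (Fin n → ℝ)} (h : IsSACell ℝ n d C) : sdim C = d := by
  obtain ⟨ι, U, φ, hι, hU, hUeq, hφc, hφs, hleft, hright⟩ := h.exists_chart
  have hUo : IsOpen U := hU.isOpen rfl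
  apply le_antisymm
  · -- no projection to more than `d` coordinates has nonempty interior
    by_contra hlt
    push Not at hlt
    obtain ⟨κ, hκ, hne⟩ := exists_sdim_witness h.nonempty
    have hφC : MapsTo φ U C := fun u hu => (hright u hu).1
    have hCeq : C = φ '' U := by
      ext x
      constructor
      · intro hx
        exact ⟨x ∘ ι, hUeq ▸ ⟨x, hx, rfl⟩, hleft x hx⟩
      · rintro ⟨v, hv, rfl⟩
        exact hφC hv
    have hproj : IsSemialgebraicMapOn ℝ univ fun x : Fin n → ℝ => x ∘ κ :=
      LinearMap.isSemialgebraicMapOn'' (LinearMap.funLeft ℝ ℝ κ) isSemialgebraic_univ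
    have h0 := interior_image_eq_empty_of_lt d hlt hUo hU.isSemialgebraic
      ((LinearMap.funLeft ℝ ℝ κ).continuous_of_finiteDimensional.comp_continuousOn hφc)
      (IsSemialgebraicMapOn.comp_holds hproj hφs (mapsTo_univ _ _))
    have himg : (fun x : Fin n → ℝ => x ∘ κ) '' C = (fun x : Fin n → ℝ => x ∘ κ) '' (φ '' U) :=
      congrArg _ hCeq
    rw [himg, ← image_comp] at hne
    have h0' : interior (((fun x : Fin n → ℝ => x ∘ κ) ∘ φ) '' U) = ∅ := h0
    rw [h0'] at hne
    exact not_nonempty_empty hne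
  · refine le_sdim hι.injective ?_
    rw [← hUeq, hUo.interior_eq, hUeq]
    exact h.nonempty.image _

/-! ### Unions, closures, images [Dries1998, Ch. 4 (1.3), (1.6), (1.8)] -/

/-- Coordinate projections are continuous linear, hence semialgebraic and continuous. [folklore] -/
theorem isSemialgebraicMapOn_proj {d : ℕ} (ι : Fin d → Fin n) {S : Set (Fin n → ℝ)}
    (hS : IsSemialgebraic ℝ S) : IsSemialgebraicMapOn ℝ S fun x : Fin n → ℝ => x ∘ ι :=
  LinearMap.isSemialgebraicMapOn'' (LinearMap.funLeft ℝ ℝ ι) hS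

/-- Coordinate projections are continuous. [folklore] -/
theorem continuous_proj {d : ℕ} (ι : Fin d → Fin n) :
    Continuous fun x : Fin n → ℝ => x ∘ ι :=
  (LinearMap.funLeft ℝ ℝ ι).continuous_of_finiteDimensional

/-- Images of semialgebraic sets under coordinate projections are semialgebraic. [folklore] -/
theorem IsSemialgebraic.image_proj {d : ℕ} (ι : Fin d → Fin n) {S : Set (Fin n → ℝ)}
    (hS : IsSemialgebraic ℝ S) : IsSemialgebraic ℝ ((fun x : Fin n → ℝ => x ∘ ι) '' S) :=
  hS.image_comp ι

/-- **Dimension of a union** [Dries1998, Ch. 4 (1.3)(iii)]. [cite: Dries1998, Ch. 4 (1.3)(iii)] -/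
theorem sdim_union {S T : Set (Fin n → ℝ)} (hS : IsSemialgebraic ℝ S) (hT : IsSemialgebraic ℝ T) :
    sdim (S ∪ T) = max (sdim S) (sdim T) := by
  refine le_antisymm ?_ (max_le (sdim_mono subset_union_left) (sdim_mono subset_union_right))
  refine csSup_le' fun d ⟨ι, hι, hne⟩ => ?_
  rw [image_union] at hne
  by_contra hlt
  push Not at hlt
  have h1 : interior ((fun x : Fin n → ℝ => x ∘ ι) '' S) = ∅ := by
    by_contra h
    exact absurd (le_sdim hι (nonempty_iff_ne_empty.mpr h)) (not_le.mpr (lt_of_le_of_lt (le_max_left _ _) hlt))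
  have h2 : interior ((fun x : Fin n → ℝ => x ∘ ι) '' T) = ∅ := by
    by_contra h
    exact absurd (le_sdim hι (nonempty_iff_ne_empty.mpr h)) (not_le.mpr (lt_of_le_of_lt (le_max_right _ _) hlt))
  have h := (hS.image_proj ι).interior_union_eq_empty (hT.image_proj ι) h1 h2
  rw [h] at hne
  exact not_nonempty_empty hne

/-- Dimension of a finite union. [cite: Dries1998, Ch. 4 (1.3)(iii)] -/
theorem sdim_biUnion_le {β : Type*} (I : Finset β) (Z : β → Set (Fin n → ℝ))
    (hs : ∀ b ∈ I, IsSemialgebraic ℝ (Z b)) {d : ℕ} (hd : ∀ b ∈ I, sdim (Z b) ≤ d) :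
    sdim (⋃ b ∈ I, Z b) ≤ d := by
  classical
  induction I using Finset.induction_on with
  | empty => simp [sdim_empty]
  | insert a I ha ih =>
    rw [Finset.set_biUnion_insert, sdim_union (hs a (Finset.mem_insert_self a I))
      (IsSemialgebraic.biUnion I _ fun b hb => hs b (Finset.mem_insert_of_mem hb))]
    exact max_le (hd a (Finset.mem_insert_self a I))
      (ih (fun b hb => hs b (Finset.mem_insert_of_mem hb)) fun b hb => hd b (Finset.mem_insert_of_mem hb))

/-- **Dimension of the closure** [Dries1998, Ch. 4 (1.8), second part].
[cite: Dries1998, Ch. 4 (1.8)] -/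
theorem sdim_closure {S : Set (Fin n → ℝ)} (hS : IsSemialgebraic ℝ S) : sdim (closure S) = sdim S := by
  refine le_antisymm (csSup_le' fun d ⟨ι, hι, hne⟩ => le_sdim hι ?_) (sdim_mono subset_closure)
  have hsub : (fun x : Fin n → ℝ => x ∘ ι) '' closure S ⊆ closure ((fun x : Fin n → ℝ => x ∘ ι) '' S) :=
    image_closure_subset_closure_image (continuous_proj ι)
  have h1 : (interior (closure ((fun x : Fin n → ℝ => x ∘ ι) '' S))).Nonempty :=
    hne.mono (interior_mono hsub)
  by_contra h
  rw [not_nonempty_iff_eq_empty] at h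
  rw [(hS.image_proj ι).interior_closure_eq_empty h] at h1
  exact not_nonempty_empty h1

/-- The dimension is the largest dimension of a cell of an adapted cylindrical decomposition
(van den Dries' definition): upper bound. [cite: Dries1998, Ch. 4 (1.1), (1.4)] -/
theorem sdim_sUnion_cells_le {𝒞 : Finset (Set (Fin n → ℝ))} {d : ℕ}
    (h : ∀ C ∈ 𝒞, ∃ d' ≤ d, IsSACell ℝ n d' C) : sdim (⋃₀ (𝒞 : Set (Set (Fin n → ℝ)))) ≤ d := by
  rw [sUnion_eq_biUnion]
  refine sdim_biUnion_le 𝒞 (fun C => C) (fun C hC => ?_) fun C hC => ?_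
  · obtain ⟨d', -, hcell⟩ := h C hC
    exact hcell.isSemialgebraic
  · obtain ⟨d', hd', hcell⟩ := h C hC
    rw [hcell.sdim_eq]
    exact hd'

/-- **Cells of an adapted decomposition have dimension at most that of the set.**
[cite: Dries1998, Ch. 4 (1.1)] -/
theorem IsSACell.le_sdim_of_subset {d : ℕ} {C S : Set (Fin n → ℝ)} (hC : IsSACell ℝ n d C) (h : C ⊆ S) :
    d ≤ sdim S := by
  rw [← hC.sdim_eq]
  exact sdim_mono h

/-- **Semialgebraic maps do not raise dimension** [Dries1998, Ch. 4 (1.6)(ii), last assertion]: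
`sdim (F '' S) ≤ sdim S` for a continuous semialgebraic map `F` on a semialgebraic `S`.
[cite: Dries1998, Ch. 4 (1.6)(ii)] -/
theorem sdim_image_le {m : ℕ} {S : Set (Fin n → ℝ)} (hS : IsSemialgebraic ℝ S)
    {F : (Fin n → ℝ) → (Fin m → ℝ)} (hFc : ContinuousOn F S) (hFs : IsSemialgebraicMapOn ℝ S F) :
    sdim (F '' S) ≤ sdim S := by
  classical
  obtain ⟨𝒟, h𝒟, hadapt⟩ := IsSemialgebraic.exists_cylindricalDecomposition_holds (k := ℝ)
    ({S} : Finset (Set (Fin n → ℝ))) (by simpa using hS)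
  obtain ⟨𝒞, h𝒞, hSeq⟩ := hadapt S (by simp)
  have himg : F '' S = ⋃ C ∈ 𝒞, F '' C := by
    rw [← hSeq, sUnion_eq_biUnion, image_iUnion₂]
    rfl
  rw [himg]
  refine sdim_biUnion_le 𝒞 _ (fun C hC => ?_) fun C hC => ?_
  · exact Literature.NumberTheory.Transcendental.IsSemialgebraicMapOn.isSemialgebraic_image_holds hFs
      (hSeq ▸ subset_sUnion_of_mem hC) (h𝒟.isSemialgebraic C (h𝒞 hC))
  · have hCS : C ⊆ S := hSeq ▸ subset_sUnion_of_mem hC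
    obtain ⟨dC, hcell⟩ := h𝒟.exists_isSACell C (h𝒞 hC)
    -- `sdim (F '' C) ≤ dC ≤ sdim S`
    refine le_trans ?_ (hcell.le_sdim_of_subset hCS)
    obtain ⟨ι, U, φ, -, hU, hUeq, hφc, hφs, hleft, hright⟩ := hcell.exists_chart
    have hφC : MapsTo φ U C := fun u hu => (hright u hu).1
    have hCeq : C = φ '' U := by
      ext x
      constructor
      · intro hx
        exact ⟨x ∘ ι, hUeq ▸ ⟨x, hx, rfl⟩, hleft x hx⟩
      · rintro ⟨v, hv, rfl⟩
        exact hφC hv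
    refine csSup_le' fun e ⟨κ, hκ, hne⟩ => ?_
    by_contra hlt
    push Not at hlt
    -- the projection of `F '' C` to `e > dC` coordinates is thin
    have h0 := interior_image_eq_empty_of_lt dC hlt (hU.isOpen rfl) hU.isSemialgebraic
      ((continuous_proj κ).comp_continuousOn ((hFc.mono hCS).comp hφc hφC))
      (IsSemialgebraicMapOn.comp_holds (isSemialgebraicMapOn_proj κ isSemialgebraic_univ)
        (IsSemialgebraicMapOn.comp_holds (hFs.mono hCS hcell.isSemialgebraic) hφs hφC)
        (mapsTo_univ _ _))
    have himg' : (fun x : Fin m → ℝ => x ∘ κ) '' (F '' C) =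
        ((fun x : Fin m → ℝ => x ∘ κ) ∘ (F ∘ φ)) '' U := by
      rw [hCeq, ← image_comp, ← image_comp]
      rfl
    rw [himg', h0] at hne
    exact not_nonempty_empty hne

/-- **Invariance under semialgebraic homeomorphisms** (the case of [Dries1998, Ch. 4 (1.3)(ii)]
for continuous semialgebraic bijections with continuous semialgebraic inverse).
[cite: Dries1998, Ch. 4 (1.3)(ii)] -/
theorem sdim_image_eq_of_inverse {m : ℕ} {S : Set (Fin n → ℝ)} {T : Set (Fin m → ℝ)}
    (hS : IsSemialgebraic ℝ S) (hT : IsSemialgebraic ℝ T)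
    {F : (Fin n → ℝ) → (Fin m → ℝ)} {G : (Fin m → ℝ) → (Fin n → ℝ)}
    (hFc : ContinuousOn F S) (hFs : IsSemialgebraicMapOn ℝ S F)
    (hGc : ContinuousOn G T) (hGs : IsSemialgebraicMapOn ℝ T G)
    (hFT : F '' S = T) (hGS : G '' T = S) : sdim T = sdim S := by
  apply le_antisymm
  · have h := sdim_image_le hS hFc hFs
    rwa [hFT] at h
  · have h := sdim_image_le hT hGc hGs
    rwa [hGS] at h

end Dimension

/-! ## Fibres of cells over the first `m` coordinates [Dries1998, Ch. 4 (1.5), proof] -/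

section Fibres

variable {m : ℕ}

/-- The fibre of `S ⊆ ℝ^{m+n}` over `a ∈ ℝᵐ`: `S_a = {y | (a, y) ∈ S}`. [cite: Dries1998, Ch. 4 (1.5)] -/
def fibre {n : ℕ} (a : Fin m → ℝ) (S : Set (Fin (m + n) → ℝ)) : Set (Fin n → ℝ) :=
  {y | Fin.append a y ∈ S}

/-- Unfolding lemma. [cite: Dries1998, Ch. 4 (1.5)] -/
theorem mem_fibre_iff {n : ℕ} {a : Fin m → ℝ} {S : Set (Fin (m + n) → ℝ)} {y : Fin n → ℝ} :
    y ∈ fibre a S ↔ Fin.append a y ∈ S :=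
  Iff.rfl

/-- The projection of `S ⊆ ℝ^{m+n}` onto the first `m` coordinates. [cite: Dries1998, Ch. 4 (1.5)] -/
def projFirst {n : ℕ} (S : Set (Fin (m + n) → ℝ)) : Set (Fin m → ℝ) :=
  (fun z : Fin (m + n) → ℝ => fun i => z (Fin.castAdd n i)) '' S

/-- `a ∈ π(S)` iff the fibre over `a` is nonempty. [cite: Dries1998, Ch. 4 (1.5)] -/
theorem mem_projFirst_iff {n : ℕ} {S : Set (Fin (m + n) → ℝ)} {a : Fin m → ℝ} :
    a ∈ projFirst S ↔ (fibre a S).Nonempty := by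
  constructor
  · rintro ⟨z, hz, rfl⟩
    refine ⟨fun j => z (Fin.natAdd m j), ?_⟩
    rw [mem_fibre_iff, Fin.append_castAdd_natAdd]
    exact hz
  · rintro ⟨y, hy⟩
    refine ⟨Fin.append a y, hy, ?_⟩
    funext i
    simp

/-- Fibres of a graph are graphs over the fibres of the base. [cite: Dries1998, Ch. 4 (1.5)] -/
theorem fibre_graphOver {n : ℕ} (a : Fin m → ℝ) (S : Set (Fin (m + n) → ℝ))
    (f : (Fin (m + n) → ℝ) → ℝ) :
    fibre (n := n + 1) a (graphOver S f) = graphOver (fibre a S) fun y => f (Fin.append a y) := by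
  ext y
  rw [mem_fibre_iff, ← Fin.snoc_init_self y, Fin.append_snoc, snoc_mem_graphOver_iff,
    snoc_mem_graphOver_iff, mem_fibre_iff]

/-- Fibres of a band are bands over the fibres of the base. [cite: Dries1998, Ch. 4 (1.5)] -/
theorem fibre_bandOver {n l : ℕ} (a : Fin m → ℝ) (S : Set (Fin (m + n) → ℝ))
    (ξ : Fin l → (Fin (m + n) → ℝ) → ℝ) (j : Fin (l + 1)) :
    fibre (n := n + 1) a (bandOver S ξ j) =
      bandOver (fibre a S) (fun i y => ξ i (Fin.append a y)) j := by
  ext y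
  rw [mem_fibre_iff, ← Fin.snoc_init_self y, Fin.append_snoc, snoc_mem_bandOver_iff,
    snoc_mem_bandOver_iff, mem_fibre_iff]
  have h1 : bandLower (fun i y => ξ i (Fin.append a y)) j (Fin.init y) =
      bandLower ξ j (Fin.append a (Fin.init y)) := bandLower_comp ξ (Fin.append a) j (Fin.init y)
  have h2 : bandUpper (fun i y => ξ i (Fin.append a y)) j (Fin.init y) =
      bandUpper ξ j (Fin.append a (Fin.init y)) := bandUpper_comp ξ (Fin.append a) j (Fin.init y)
  rw [h1, h2]

/-- `y ↦ (a, y)` is a real-semialgebraic map (constants and coordinates). [folklore] -/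
theorem isSemialgebraicMapOn_append_const {n : ℕ} (a : Fin m → ℝ) {T : Set (Fin n → ℝ)}
    (hT : IsSemialgebraic ℝ T) : IsSemialgebraicMapOn ℝ T fun y => (Fin.append a y : Fin (m + n) → ℝ) := by
  refine IsSemialgebraicMapOn.of_forall hT fun l => ?_
  refine Fin.addCases (fun i => ?_) (fun j => ?_) l
  · simp only [Fin.append_left]
    simpa using isSemialgebraicFunOn_algebraMap hT (a i)
  · simp only [Fin.append_right]
    exact isSemialgebraicFunOn_apply hT j

/-- `y ↦ (a, y)` is continuous. [folklore] -/
theorem continuous_append_const {n : ℕ} (a : Fin m → ℝ) :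
    Continuous fun y : Fin n → ℝ => (Fin.append a y : Fin (m + n) → ℝ) := by
  refine continuous_pi fun l => ?_
  refine Fin.addCases (fun i => ?_) (fun j => ?_) l
  · simp only [Fin.append_left]
    exact continuous_const
  · simp only [Fin.append_right]
    exact continuous_apply j

/-- **Fibres of a cylindrical decomposition** [Dries1998, Ch. 4 (1.5), the displayed formula
`dim C = dim π C + dim C_a`; Ch. 3 (3.5)(i)]: a cylindrical decomposition of `ℝ^{m+n}` is the
`n`-fold stack over a cylindrical decomposition `𝒟ₘ` of `ℝᵐ`; every cell `C` projects onto a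
cell `A ∈ 𝒟ₘ` and its fibres `C_a`, `a ∈ A`, are cells of `ℝⁿ` of dimension `dim C - dim A`.
[cite: Dries1998, Ch. 4 (1.5)] -/
theorem IsCylindricalDecomposition.exists_base_fibres {k : Type*} [CommRing k] [Algebra k ℝ] :
    ∀ (n : ℕ) {𝒟 : Finset (Set (Fin (m + n) → ℝ))}, IsCylindricalDecomposition k (m + n) 𝒟 →
      ∃ 𝒟ₘ : Finset (Set (Fin m → ℝ)), IsCylindricalDecomposition k m 𝒟ₘ ∧
        ∀ C ∈ 𝒟, ∃ A ∈ 𝒟ₘ, ∃ dA dC : ℕ, IsSACell ℝ m dA A ∧ IsSACell ℝ (m + n) dC C ∧ dA ≤ dC ∧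
          projFirst C = A ∧ ∀ a ∈ A, IsSACell ℝ n (dC - dA) (fibre a C)
  | 0, 𝒟, h => by
    refine ⟨𝒟, h, fun C hC => ?_⟩
    obtain ⟨d, hcell⟩ := h.exists_isSACell C hC
    have hcellR : IsSACell ℝ (m + 0) d C := hcell.real
    refine ⟨C, hC, d, d, hcellR, hcellR, le_rfl, ?_, fun a ha => ?_⟩
    · ext a
      rw [mem_projFirst_iff]
      constructor
      · rintro ⟨y, hy⟩
        rw [mem_fibre_iff, show y = Fin.elim0 from Subsingleton.elim _ _, Fin.append_elim0'] at hy
        exact hy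
      · intro ha
        refine ⟨Fin.elim0, ?_⟩
        rw [mem_fibre_iff, Fin.append_elim0']
        exact ha
    · have : fibre a C = univ := eq_univ_of_forall fun y => by
        rw [mem_fibre_iff, show y = Fin.elim0 from Subsingleton.elim _ _, Fin.append_elim0']
        exact ha
      rw [this, Nat.sub_self]
      exact IsSACell.zero
  | n + 1, 𝒟, h => by
    obtain ⟨𝒟', h𝒟', l, ξ, hcont, hsa, hmono, hmem⟩ := h.2.2
    obtain ⟨𝒟ₘ, h𝒟ₘ, hIH⟩ := IsCylindricalDecomposition.exists_base_fibres n h𝒟'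
    refine ⟨𝒟ₘ, h𝒟ₘ, fun C hC => ?_⟩
    obtain ⟨B, hB, hCB⟩ := (hmem C).mp hC
    obtain ⟨A, hA, dA, dB, hAcell, hBcell, hAB, hprojB, hfibB⟩ := hIH B hB
    have hfibB_sub : ∀ a ∈ A, MapsTo (fun y : Fin n → ℝ => (Fin.append a y : Fin (m + n) → ℝ))
        (fibre a B) B := fun a _ y hy => hy
    -- projection of a graph / band onto the first `m` coordinates is that of its base
    have hproj_graph : ∀ (g : (Fin (m + n) → ℝ) → ℝ), projFirst (n := n + 1) (graphOver B g) = A := by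
      intro g
      rw [← hprojB]
      ext a
      simp only [mem_projFirst_iff]
      rw [fibre_graphOver]
      constructor
      · rintro ⟨y, hy⟩
        exact ⟨Fin.init y, hy.1⟩
      · rintro ⟨y, hy⟩
        exact ⟨Fin.snoc y (g (Fin.append a y)), by simp [hy]⟩
    have hproj_band : ∀ (j : Fin (l B + 1)), projFirst (n := n + 1) (bandOver B (ξ B) j) = A := by
      intro j
      rw [← hprojB]
      ext a
      simp only [mem_projFirst_iff]
      rw [fibre_bandOver]
      constructor
      · rintro ⟨y, hy⟩
        exact ⟨Fin.init y, hy.1⟩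
      · rintro ⟨y, hy⟩
        have hcont' : ∀ i, ContinuousOn (fun y' : Fin n → ℝ => ξ B i (Fin.append a y')) (fibre a B) :=
          fun i => (hcont B hB i).comp (continuous_append_const a).continuousOn
            (hfibB_sub a ((hprojB ▸ mem_projFirst_iff.mpr ⟨y, hy⟩)))
        have hmono' : ∀ y' ∈ fibre a B, StrictMono fun i => ξ B i (Fin.append a y') :=
          fun y' hy' => hmono B hB _ hy'
        obtain ⟨mm, -, hmm⟩ := exists_continuousOn_snoc_mem_bandOver hcont' hmono' j
        exact ⟨_, hmm y hy⟩
    rcases hCB with ⟨j, rfl⟩ | ⟨j, rfl⟩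
    · refine ⟨A, hA, dA, dB, hAcell, (hBcell.graph (hcont B hB j) (hsa B hB j).real_of), hAB,
        hproj_graph _, fun a ha => ?_⟩
      rw [fibre_graphOver]
      have haB : (fibre a B).Nonempty := by
        rw [← mem_projFirst_iff, hprojB]
        exact ha
      refine (hfibB a ha).graph ?_ ?_
      · exact (hcont B hB j).comp (continuous_append_const a).continuousOn (hfibB_sub a ha)
      · exact IsSemialgebraicFunOn.comp_isSemialgebraicMapOn_holds (hsa B hB j).real_of
          (isSemialgebraicMapOn_append_const a (hfibB a ha).isSemialgebraic) (hfibB_sub a ha)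
    · refine ⟨A, hA, dA, dB + 1, hAcell, ?_, hAB.trans (Nat.le_succ _), hproj_band _, fun a ha => ?_⟩
      · exact IsSACell.band j hBcell (hcont B hB) (fun i => (hsa B hB i).real_of) (hmono B hB)
      · rw [fibre_bandOver, Nat.succ_sub hAB]
        refine IsSACell.band j (hfibB a ha) (fun i => ?_) (fun i => ?_) fun y hy => hmono B hB _ hy
        · exact (hcont B hB i).comp (continuous_append_const a).continuousOn (hfibB_sub a ha)
        · exact IsSemialgebraicFunOn.comp_isSemialgebraicMapOn_holds (hsa B hB i).real_of
            (isSemialgebraicMapOn_append_const a (hfibB a ha).isSemialgebraic) (hfibB_sub a ha)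

end Fibres

/-! ## The fibre dimension formula [Dries1998, Ch. 4 (1.5)] -/

section FibreFormula

variable {m n : ℕ}

/-- The dimension of a finite union of cells is the largest cell dimension (equality form).
[cite: Dries1998, Ch. 4 (1.3)(iii), (1.4)] -/
theorem sdim_biUnion_cells_eq {β : Type*} {p : ℕ} (I : Finset β) (Z : β → Set (Fin p → ℝ)) (dim : β → ℕ)
    (h : ∀ b ∈ I, IsSACell ℝ p (dim b) (Z b)) (hI : I.Nonempty) :
    sdim (⋃ b ∈ I, Z b) = I.sup dim := by
  apply le_antisymm
  · exact sdim_biUnion_le I Z (fun b hb => (h b hb).isSemialgebraic) fun b hb => by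
      rw [(h b hb).sdim_eq]; exact Finset.le_sup hb
  · obtain ⟨b, hb, hmax⟩ := Finset.exists_mem_eq_sup I hI dim
    rw [hmax]
    exact (h b hb).le_sdim_of_subset (subset_biUnion_of_mem hb)

/-- **The fibre dimension formula** [Dries1998, Ch. 4 (1.5)]: for a semialgebraic
`S ⊆ ℝᵐ × ℝⁿ` and `d`, the set `S(d)` of `a ∈ ℝᵐ` with nonempty fibre `S_a` of dimension `d` is
semialgebraic, and the part of `S` above `S(d)` has dimension `dim S(d) + d`.
[cite: Dries1998, Ch. 4 (1.5)] -/
theorem sdim_fibre_formula {S : Set (Fin (m + n) → ℝ)} (hS : IsSemialgebraic ℝ S) (d : ℕ) :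
    IsSemialgebraic ℝ {a : Fin m → ℝ | (fibre a S).Nonempty ∧ sdim (fibre a S) = d} ∧
    ({a : Fin m → ℝ | (fibre a S).Nonempty ∧ sdim (fibre a S) = d}.Nonempty →
      sdim {z | z ∈ S ∧ (fibre (fun i => z (Fin.castAdd n i)) S).Nonempty ∧
          sdim (fibre (fun i => z (Fin.castAdd n i)) S) = d} =
        sdim {a : Fin m → ℝ | (fibre a S).Nonempty ∧ sdim (fibre a S) = d} + d) := by
  classical
  obtain ⟨𝒟, h𝒟, hadapt⟩ := IsSemialgebraic.exists_cylindricalDecomposition_holds (k := ℝ)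
    ({S} : Finset (Set (Fin (m + n) → ℝ))) (by simpa using hS)
  obtain ⟨𝒞, h𝒞, hSeq⟩ := hadapt S (by simp)
  obtain ⟨𝒟ₘ, h𝒟ₘ, hbase⟩ := IsCylindricalDecomposition.exists_base_fibres (m := m) n h𝒟
  choose! Ab hAb dA dC hAcell hCcell hAC hproj hfib using hbase
  have hpartₘ := h𝒟ₘ.isPartition
  -- the fibre of `S` over `a` in terms of the cells over the base cell of `a`
  have hfibS : ∀ a, fibre a S = ⋃ C ∈ 𝒞.filter (fun C => a ∈ Ab C), fibre a C := by
    intro a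
    ext y
    simp only [mem_fibre_iff, mem_iUnion, Finset.mem_filter, exists_prop]
    constructor
    · intro hy
      rw [← hSeq] at hy
      obtain ⟨C, hC, hyC⟩ := mem_sUnion.mp hy
      refine ⟨C, ⟨hC, ?_⟩, hyC⟩
      rw [← hproj C (h𝒞 hC), mem_projFirst_iff]
      exact ⟨y, hyC⟩
    · rintro ⟨C, ⟨hC, -⟩, hyC⟩
      rw [← hSeq]
      exact mem_sUnion_of_mem hyC hC
  -- dimension of the fibre over `a`: the largest `dC - dA` among the cells over the base cell of `a`
  have hfibdim : ∀ a, (𝒞.filter fun C => a ∈ Ab C).Nonempty →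
      sdim (fibre a S) = (𝒞.filter fun C => a ∈ Ab C).sup fun C => dC C - dA C := by
    intro a hne
    rw [hfibS a]
    exact sdim_biUnion_cells_eq _ _ _ (fun C hC => by
      obtain ⟨hC𝒞, ha⟩ := Finset.mem_filter.mp hC
      exact hfib C (h𝒞 hC𝒞) a ha) hne
  have hfibne : ∀ a, (fibre a S).Nonempty ↔ (𝒞.filter fun C => a ∈ Ab C).Nonempty := by
    intro a
    rw [hfibS a]
    simp only [nonempty_iUnion, Finset.mem_filter, exists_prop]
    constructor
    · rintro ⟨C, hC, -⟩
      exact ⟨C, Finset.mem_filter.mpr hC⟩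
    · rintro ⟨C, hC⟩
      obtain ⟨hC𝒞, ha⟩ := Finset.mem_filter.mp hC
      refine ⟨C, ⟨hC𝒞, ha⟩, ?_⟩
      rw [← mem_projFirst_iff, hproj C (h𝒞 hC𝒞)]
      exact ha
  -- the cells over a fixed base cell `A`: the filter only depends on the base cell of `a`
  have hfilter : ∀ A ∈ 𝒟ₘ, ∀ a ∈ A, (𝒞.filter fun C => a ∈ Ab C) = 𝒞.filter fun C => Ab C = A := by
    intro A hA a ha
    ext C
    simp only [Finset.mem_filter, and_congr_right_iff]
    intro hC
    constructor
    · intro ha'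
      exact hpartₘ.eq_of_mem_of_mem (hAb C (h𝒞 hC)) hA ha' ha
    · rintro rfl
      exact ha
  -- the predicate on base cells and the description of `S(d)`
  let P : Set (Fin m → ℝ) → Prop := fun A =>
    (𝒞.filter fun C => Ab C = A).Nonempty ∧ ((𝒞.filter fun C => Ab C = A).sup fun C => dC C - dA C) = d
  have hSd : {a : Fin m → ℝ | (fibre a S).Nonempty ∧ sdim (fibre a S) = d} = ⋃ A ∈ 𝒟ₘ.filter P, A := by
    ext a
    obtain ⟨A, ⟨hA, ha⟩, -⟩ := hpartₘ.2 a
    simp only [mem_setOf_eq, mem_iUnion, Finset.mem_filter, exists_prop]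
    rw [hfibne a, hfilter A hA a ha]
    constructor
    · rintro ⟨hne, hdim⟩
      refine ⟨A, ⟨hA, hne, ?_⟩, ha⟩
      rw [← hdim, hfibdim a (by rwa [hfilter A hA a ha]), hfilter A hA a ha]
    · rintro ⟨A', ⟨hA', hne', hsup'⟩, ha'⟩
      have hAA' : A' = A := hpartₘ.eq_of_mem_of_mem hA' hA ha' ha
      subst hAA'
      refine ⟨hne', ?_⟩
      rw [hfibdim a (by rwa [hfilter A' hA a ha]), hfilter A' hA a ha]
      exact hsup'
  refine ⟨?_, fun hne => ?_⟩
  · rw [hSd]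
    exact IsSemialgebraic.biUnion _ _ fun A hA => h𝒟ₘ.isSemialgebraic A (Finset.mem_filter.mp hA).1
  -- the part of `S` above `S(d)` is the union of the cells `C ∈ 𝒞` with `P (Ab C)`
  have hT : {z | z ∈ S ∧ (fibre (fun i => z (Fin.castAdd n i)) S).Nonempty ∧
      sdim (fibre (fun i => z (Fin.castAdd n i)) S) = d} = ⋃ C ∈ 𝒞.filter (fun C => P (Ab C)), C := by
    ext z
    have hz' : ∀ C ∈ 𝒞, z ∈ C → (fun i => z (Fin.castAdd n i)) ∈ Ab C := fun C hC hzC => by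
      rw [← hproj C (h𝒞 hC)]
      exact ⟨z, hzC, rfl⟩
    simp only [mem_setOf_eq, mem_iUnion, Finset.mem_filter, exists_prop]
    constructor
    · rintro ⟨hzS, hrest⟩
      have hmem : (fun i => z (Fin.castAdd n i)) ∈ {a : Fin m → ℝ | (fibre a S).Nonempty ∧ sdim (fibre a S) = d} :=
        hrest
      rw [hSd] at hmem
      simp only [mem_iUnion, Finset.mem_filter, exists_prop] at hmem
      obtain ⟨A, ⟨hA, hPA⟩, haA⟩ := hmem
      rw [← hSeq] at hzS
      obtain ⟨C, hC, hzC⟩ := mem_sUnion.mp hzS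
      have hAC' : Ab C = A := hpartₘ.eq_of_mem_of_mem (hAb C (h𝒞 hC)) hA (hz' C hC hzC) haA
      exact ⟨C, ⟨hC, hAC' ▸ hPA⟩, hzC⟩
    · rintro ⟨C, ⟨hC, hPC⟩, hzC⟩
      refine ⟨hSeq ▸ mem_sUnion_of_mem hzC hC, ?_⟩
      show (fun i => z (Fin.castAdd n i)) ∈ {a : Fin m → ℝ | (fibre a S).Nonempty ∧ sdim (fibre a S) = d}
      rw [hSd]
      simp only [mem_iUnion, Finset.mem_filter, exists_prop]
      exact ⟨Ab C, ⟨hAb C (h𝒞 hC), hPC⟩, hz' C hC hzC⟩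
  -- both sides are maxima over cells
  have h𝒞P : (𝒞.filter fun C => P (Ab C)).Nonempty := by
    obtain ⟨a, ha⟩ := hne
    rw [hSd] at ha
    simp only [mem_iUnion, Finset.mem_filter, exists_prop] at ha
    obtain ⟨A, ⟨-, hPA⟩, -⟩ := ha
    obtain ⟨C, hC⟩ := hPA.1
    obtain ⟨hC𝒞, hAC'⟩ := Finset.mem_filter.mp hC
    exact ⟨C, Finset.mem_filter.mpr ⟨hC𝒞, by rw [hAC']; exact hPA⟩⟩
  have hdimA : ∀ C ∈ 𝒞, sdim (Ab C) = dA C := fun C hC => (hAcell C (h𝒞 hC)).sdim_eq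
  have hcellA : ∀ A ∈ 𝒟ₘ.filter P, IsSACell ℝ m (sdim A) A := by
    intro A hA
    obtain ⟨hA𝒟, ⟨C, hC⟩, -⟩ := Finset.mem_filter.mp hA
    obtain ⟨hC𝒞, hAC'⟩ := Finset.mem_filter.mp hC
    rw [← hAC', hdimA C hC𝒞]
    exact hAcell C (h𝒞 hC𝒞)
  have h𝒟P : (𝒟ₘ.filter P).Nonempty := by
    obtain ⟨C, hC⟩ := h𝒞P
    obtain ⟨hC𝒞, hPC⟩ := Finset.mem_filter.mp hC
    exact ⟨Ab C, Finset.mem_filter.mpr ⟨hAb C (h𝒞 hC𝒞), hPC⟩⟩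
  rw [hT, hSd, sdim_biUnion_cells_eq _ _ dC (fun C hC => hCcell C (h𝒞 (Finset.mem_filter.mp hC).1)) h𝒞P,
    sdim_biUnion_cells_eq _ _ sdim hcellA h𝒟P]
  apply le_antisymm
  · refine Finset.sup_le fun C hC => ?_
    obtain ⟨hC𝒞, hPC⟩ := Finset.mem_filter.mp hC
    have h1 : dC C - dA C ≤ d := by
      rw [← hPC.2]
      exact Finset.le_sup (f := fun C => dC C - dA C) (Finset.mem_filter.mpr ⟨hC𝒞, rfl⟩)
    have h2 : sdim (Ab C) ≤ (𝒟ₘ.filter P).sup sdim :=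
      Finset.le_sup (f := sdim) (Finset.mem_filter.mpr ⟨hAb C (h𝒞 hC𝒞), hPC⟩)
    have h3 := hAC C (h𝒞 hC𝒞)
    rw [hdimA C hC𝒞] at h2
    omega
  · obtain ⟨A, hA, hmax⟩ := Finset.exists_mem_eq_sup _ h𝒟P sdim
    obtain ⟨hA𝒟, hne', hsup'⟩ := Finset.mem_filter.mp hA
    obtain ⟨C', hC', hmax'⟩ := Finset.exists_mem_eq_sup _ hne' fun C => dC C - dA C
    obtain ⟨hC'𝒞, hAC''⟩ := Finset.mem_filter.mp hC'
    have hPC' : P (Ab C') := by rw [hAC'']; exact ⟨hne', hsup'⟩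
    have h1 : dC C' ≤ (𝒞.filter fun C => P (Ab C)).sup dC :=
      Finset.le_sup (f := dC) (Finset.mem_filter.mpr ⟨hC'𝒞, hPC'⟩)
    have h2 : dC C' - dA C' = d := by rw [← hmax']; exact hsup'
    have h3 := hAC C' (h𝒞 hC'𝒞)
    have h4 : sdim A = dA C' := by rw [← hAC'']; exact hdimA C' hC'𝒞
    rw [hmax, h4]
    omega

end FibreFormula

/-! ## Towards the frontier inequality: fibres of closures, permutations, small sets
[Dries1998, Ch. 4 (1.7)–(1.8)] -/

section FrontierPrelim

variable {m n : ℕ}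

/-- The closure of a fibre lies in the fibre of the closure. [cite: Dries1998, Ch. 4 (1.7), proof] -/
theorem closure_fibre_subset (a : Fin m → ℝ) (S : Set (Fin (m + n) → ℝ)) :
    closure (fibre a S) ⊆ fibre a (closure S) := by
  have h : fibre a S = (fun y : Fin n → ℝ => (Fin.append a y : Fin (m + n) → ℝ)) ⁻¹' S := rfl
  have h' : fibre a (closure S) = (fun y : Fin n → ℝ => (Fin.append a y : Fin (m + n) → ℝ)) ⁻¹' closure S := rfl
  rw [h, h']
  exact (continuous_append_const a).closure_preimage_subset S

/-- The frontier `cl S_a ∖ S_a` of a fibre lies in the fibre of the frontier `cl S ∖ S`.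
[cite: Dries1998, Ch. 4 (1.7), proof] -/
theorem closure_fibre_diff_subset (a : Fin m → ℝ) (S : Set (Fin (m + n) → ℝ)) :
    closure (fibre a S) \ fibre a S ⊆ fibre a (closure S \ S) := fun _ hy =>
  ⟨closure_fibre_subset a S hy.1, hy.2⟩

/-- Fibres of semialgebraic sets over real points are real-semialgebraic.
[cite: BochnakCosteRoy1998, §2.2] -/
theorem IsSemialgebraic.fibre (a : Fin m → ℝ) {S : Set (Fin (m + n) → ℝ)} (hS : IsSemialgebraic ℝ S) :
    IsSemialgebraic ℝ (fibre a S) := by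
  have heq : ∀ y : Fin n → ℝ, (fun l : Fin (m + n) => MvPolynomial.aeval y
      (Fin.addCases (fun i => MvPolynomial.C (a i)) (fun j => MvPolynomial.X j) l :
        MvPolynomial (Fin n) ℝ)) = Fin.append a y := by
    intro y
    funext l
    refine Fin.addCases (fun i => ?_) (fun j => ?_) l
    · simp
    · simp
  have h := hS.preimage_aeval (fun l : Fin (m + n) =>
    (Fin.addCases (fun i => MvPolynomial.C (a i)) (fun j => MvPolynomial.X j) l : MvPolynomial (Fin n) ℝ))
  convert h using 1
  ext y
  rw [mem_fibre_iff, mem_preimage, heq y]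

/-- The dimension is invariant under permutations of the coordinates.
[cite: Dries1998, Ch. 4 (1.3)(ii)] -/
theorem sdim_image_funCongrLeft {p : ℕ} (σ : Fin p ≃ Fin p) {S : Set (Fin p → ℝ)}
    (hS : IsSemialgebraic ℝ S) : sdim ((fun x : Fin p → ℝ => x ∘ σ) '' S) = sdim S := by
  have hT : IsSemialgebraic ℝ ((fun x : Fin p → ℝ => x ∘ σ) '' S) := hS.image_comp σ
  refine sdim_image_eq_of_inverse hS hT (continuous_proj σ).continuousOn
    (isSemialgebraicMapOn_proj σ hS) (continuous_proj σ.symm).continuousOn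
    (isSemialgebraicMapOn_proj σ.symm hT) rfl ?_
  rw [image_image]
  convert image_id S using 2 with x
  funext i
  simp

/-- Finite sets have dimension `0`. [cite: Dries1998, Ch. 4 (1.1)] -/
theorem sdim_eq_zero_of_finite {p : ℕ} {S : Set (Fin p → ℝ)} (hS : S.Finite) : sdim S = 0 := by
  apply Nat.eq_zero_of_le_zero
  refine csSup_le' fun d ⟨ι, hι, hne⟩ => ?_
  by_contra hd
  have hfin : ((fun x : Fin p → ℝ => x ∘ ι) '' S).Finite := hS.image _
  -- a finite subset of `ℝᵈ`, `d ≥ 1`, has empty interior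
  obtain ⟨u, hu⟩ := hne
  obtain ⟨ε, hε, hball⟩ := Metric.isOpen_iff.mp isOpen_interior u hu
  have hd1 : 0 < d := by omega
  -- the segment `u + t e₀`, `t ∈ (0, ε)`, lies in the finite set: contradiction
  have hinj : Set.InjOn (fun t : ℝ => u + t • (Pi.single ⟨0, hd1⟩ 1 : Fin d → ℝ)) (Ioo 0 ε) := by
    intro t _ t' _ h
    have := congr_fun h ⟨0, hd1⟩
    simpa using this
  have hsub : (fun t : ℝ => u + t • (Pi.single ⟨0, hd1⟩ 1 : Fin d → ℝ)) '' Ioo 0 ε ⊆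
      (fun x : Fin p → ℝ => x ∘ ι) '' S := by
    rintro _ ⟨t, ht, rfl⟩
    refine interior_subset (hball ?_)
    rw [Metric.mem_ball, dist_eq_norm, add_sub_cancel_left, norm_smul, Real.norm_eq_abs,
      abs_of_pos ht.1]
    have : ‖(Pi.single (⟨0, hd1⟩ : Fin d) (1 : ℝ) : Fin d → ℝ)‖ = 1 := by
      rw [Pi.norm_single, norm_one]
    rw [this, mul_one]
    exact ht.2
  have hinf : (Ioo (0 : ℝ) ε).Infinite := Ioo_infinite hε
  exact hinf ((hfin.subset hsub).of_finite_image hinj)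

/-- A set containing a non-degenerate segment parallel to a coordinate axis has dimension `≥ 1`.
[cite: Dries1998, Ch. 4 (1.1)] -/
theorem one_le_sdim_of_Ioo_subset {p : ℕ} {S : Set (Fin p → ℝ)} (i : Fin p) (x : Fin p → ℝ) {a b : ℝ}
    (hab : a < b) (h : ∀ t ∈ Ioo a b, Function.update x i t ∈ S) : 1 ≤ sdim S := by
  refine le_sdim (ι := fun _ : Fin 1 => i) (fun j j' _ => Subsingleton.elim _ _) ?_
  -- the projection to the `i`-th coordinate contains `(a, b)`
  have hsub : (fun t : ℝ => fun _ : Fin 1 => t) '' Ioo a b ⊆ (fun y : Fin p → ℝ => y ∘ fun _ : Fin 1 => i) '' S := by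
    rintro _ ⟨t, ht, rfl⟩
    refine ⟨Function.update x i t, h t ht, ?_⟩
    funext j
    simp
  have hopen : IsOpen ((fun t : ℝ => fun _ : Fin 1 => t) '' Ioo a b) := by
    have : (fun t : ℝ => fun _ : Fin 1 => t) '' Ioo a b = {z : Fin 1 → ℝ | z 0 ∈ Ioo a b} := by
      ext z
      constructor
      · rintro ⟨t, ht, rfl⟩
        exact ht
      · intro hz
        exact ⟨z 0, hz, funext fun j => by rw [Subsingleton.elim j 0]⟩
    rw [this]
    exact isOpen_Ioo.preimage (continuous_apply 0)
  obtain ⟨t, ht⟩ : (Ioo a b).Nonempty := nonempty_Ioo.mpr hab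
  exact ⟨fun _ => t, interior_mono hsub (by rw [hopen.interior_eq]; exact ⟨t, ht, rfl⟩)⟩

end FrontierPrelim

/-! ## Van den Dries' Lemma (1.7): frontiers of fibres are fibres of the frontier, save over
finitely many points -/

section FrontierLemma

open Literature.NumberTheory.Transcendental.SemialgebraicMonotonicity

variable {p : ℕ}

/-- Finite conjunctions of real-semialgebraic conditions (copy of `sa_fin_forall` of the lifting
file, which is not imported here). [cite: BochnakCosteRoy1998, §2.1] -/
theorem sa_fin_forall' {q : ℕ} {ι : Type*} [Fintype ι] {Q : ι → (Fin q → ℝ) → Prop}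
    (h : ∀ i, IsSemialgebraic ℝ {z | Q i z}) : IsSemialgebraic ℝ {z | ∀ i, Q i z} := by
  have h' := IsSemialgebraic.biInter (k := ℝ) Finset.univ (fun i => {z : Fin q → ℝ | Q i z})
    fun i _ => h i
  convert h' using 1
  ext z
  simp

/-- The coordinate bookkeeping of `ℝ¹ × ℝ²ᵖ × ℝᵖ`: `u ∘ θ = (x(u), y(u))`. [folklore] -/
theorem comp_appendIdx (u : Fin (1 + (p + p) + p) → ℝ) :
    (u ∘ (Fin.append (fun i : Fin 1 => Fin.castAdd p (Fin.castAdd (p + p) i))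
      (fun j : Fin p => Fin.natAdd (1 + (p + p)) j) : Fin (1 + p) → Fin (1 + (p + p) + p))) =
      Fin.append (fun i : Fin 1 => u (Fin.castAdd p (Fin.castAdd (p + p) i)))
        (fun j : Fin p => u (Fin.natAdd (1 + (p + p)) j)) := by
  funext l
  refine Fin.addCases (fun i => ?_) (fun j => ?_) l
  · simp
  · simp

/-- **Lemma (1.7) of [Dries1998, Ch. 4]** (semialgebraic case): for a semialgebraic
`A ⊆ ℝ × ℝᵖ`, the frontier of the fibre `A_x` equals the fibre of the frontier of `A` for all but
finitely many `x ∈ ℝ` (frontier = `cl ∖` the set). Proof as printed: boxes `B(a,b)` missing `A_x`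
but meeting `(cl A)_x` form a semialgebraic `C ⊆ ℝ × ℝ²ᵖ` whose fibres over `(a, b)` are finite
(claim 1) and whose fibres over bad `x` have nonempty interior (claim 2); the fibre dimension
formula (1.5) applied both ways bounds `dim C` by `2p` from above and by `1 + 2p` from below if
there were infinitely many bad `x`. [cite: Dries1998, Ch. 4 (1.7)] -/
theorem finite_setOf_frontier_fibre_ne {A : Set (Fin (1 + p) → ℝ)} (hA : IsSemialgebraic ℝ A) :
    {x : Fin 1 → ℝ | closure (fibre x A) \ fibre x A ≠ fibre x (closure A \ A)}.Finite := by
  classical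
  have hclA : IsSemialgebraic ℝ (closure A) := isSemialgebraic_closure hA
  -- the predicate defining `C` and the set `C ⊆ ℝ¹ × ℝ²ᵖ`
  let box : (Fin (p + p) → ℝ) → (Fin p → ℝ) → Prop := fun ab y =>
    ∀ i, ab (Fin.castAdd p i) < y i ∧ y i < ab (Fin.natAdd p i)
  let P : (Fin 1 → ℝ) → (Fin (p + p) → ℝ) → Prop := fun x ab =>
    (∀ i, ab (Fin.castAdd p i) < ab (Fin.natAdd p i)) ∧
      (∀ y, box ab y → Fin.append x y ∉ A) ∧ ∃ y, box ab y ∧ Fin.append x y ∈ closure A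
  set C : Set (Fin (1 + (p + p)) → ℝ) :=
    {w | P (fun i => w (Fin.castAdd (p + p) i)) (fun k => w (Fin.natAdd 1 k))} with hC
  have hfibC : ∀ x, fibre x C = {ab | P x ab} := by
    intro x
    ext ab
    simp only [mem_fibre_iff, hC, mem_setOf_eq, Fin.append_left, Fin.append_right]
  -- `C` is semialgebraic
  have hCs : IsSemialgebraic ℝ C := by
    have h1 : IsSemialgebraic ℝ {w : Fin (1 + (p + p)) → ℝ |
        ∀ i : Fin p, w (Fin.natAdd 1 (Fin.castAdd p i)) < w (Fin.natAdd 1 (Fin.natAdd p i))} :=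
      sa_fin_forall' fun i => sa_lt _ _
    -- the inner sets over `(w, y) ∈ ℝ^{1+2p} × ℝᵖ`
    have hbox : IsSemialgebraic ℝ {u : Fin (1 + (p + p) + p) → ℝ |
        ∀ i : Fin p, u (Fin.castAdd p (Fin.natAdd 1 (Fin.castAdd p i))) < u (Fin.natAdd (1 + (p + p)) i) ∧
          u (Fin.natAdd (1 + (p + p)) i) < u (Fin.castAdd p (Fin.natAdd 1 (Fin.natAdd p i)))} :=
      sa_fin_forall' fun i => sa_and (sa_lt _ _) (sa_lt _ _)
    let θ : Fin (1 + p) → Fin (1 + (p + p) + p) :=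
      Fin.append (fun i : Fin 1 => Fin.castAdd p (Fin.castAdd (p + p) i))
        (fun j : Fin p => Fin.natAdd (1 + (p + p)) j)
    have hmemA : IsSemialgebraic ℝ {u : Fin (1 + (p + p) + p) → ℝ |
        (Fin.append (fun i : Fin 1 => u (Fin.castAdd p (Fin.castAdd (p + p) i)))
          (fun j : Fin p => u (Fin.natAdd (1 + (p + p)) j)) : Fin (1 + p) → ℝ) ∈ A} := by
      have h := hA.preimage_comp θ
      convert h using 1
      ext u
      rw [mem_setOf_eq, mem_preimage, comp_appendIdx]
    have hmemclA : IsSemialgebraic ℝ {u : Fin (1 + (p + p) + p) → ℝ |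
        (Fin.append (fun i : Fin 1 => u (Fin.castAdd p (Fin.castAdd (p + p) i)))
          (fun j : Fin p => u (Fin.natAdd (1 + (p + p)) j)) : Fin (1 + p) → ℝ) ∈ closure A} := by
      have h := hclA.preimage_comp θ
      convert h using 1
      ext u
      rw [mem_setOf_eq, mem_preimage, comp_appendIdx]
    have h2 := sa_forall_block (m := 1 + (p + p)) (n := p)
      (P := fun w y => box (fun k => w (Fin.natAdd 1 k)) y →
        Fin.append (fun i => w (Fin.castAdd (p + p) i)) y ∉ A)
      (by simpa [box] using sa_imp hbox (sa_not hmemA))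
    have h3 := sa_exists_block (m := 1 + (p + p)) (n := p)
      (P := fun w y => box (fun k => w (Fin.natAdd 1 k)) y ∧
        Fin.append (fun i => w (Fin.castAdd (p + p) i)) y ∈ closure A)
      (by simpa [box] using sa_and hbox hmemclA)
    have hCeq : C = {w | ∀ i : Fin p, w (Fin.natAdd 1 (Fin.castAdd p i)) < w (Fin.natAdd 1 (Fin.natAdd p i))} ∩
        ({w | ∀ y, box (fun k => w (Fin.natAdd 1 k)) y → Fin.append (fun i => w (Fin.castAdd (p + p) i)) y ∉ A} ∩
          {w | ∃ y, box (fun k => w (Fin.natAdd 1 k)) y ∧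
            Fin.append (fun i => w (Fin.castAdd (p + p) i)) y ∈ closure A}) := by
      ext w
      simp only [hC, mem_setOf_eq, mem_inter_iff, P]
    rw [hCeq]
    exact h1.inter (h2.inter h3)
  -- membership of appended points in `C`
  have hmemC : ∀ (x : Fin 1 → ℝ) (ab : Fin (p + p) → ℝ), (Fin.append x ab : Fin (1 + (p + p)) → ℝ) ∈ C ↔ P x ab := by
    intro x ab
    simp only [hC, mem_setOf_eq, Fin.append_left, Fin.append_right]
  -- points of `ℝ^{1+p}` split as `(x, y)`
  have hsplit : ∀ z : Fin (1 + p) → ℝ, Fin.append (fun i : Fin 1 => z (Fin.castAdd p i))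
      (fun j : Fin p => z (Fin.natAdd 1 j)) = z := fun z => Fin.append_castAdd_natAdd
  -- claim 1: for fixed `(a, b)` only finitely many `x`
  have hclaim1 : ∀ ab : Fin (p + p) → ℝ, {x : Fin 1 → ℝ | P x ab}.Finite := by
    intro ab
    by_contra hinf
    have hsaX : IsSemialgebraic ℝ {x : Fin 1 → ℝ | P x ab} := by
      have heq : ∀ x : Fin 1 → ℝ, (fun l : Fin (1 + (p + p)) => MvPolynomial.aeval x
          (Fin.addCases (fun i => MvPolynomial.X i) (fun k => MvPolynomial.C (ab k)) l :
            MvPolynomial (Fin 1) ℝ)) = Fin.append x ab := by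
        intro x
        funext l
        refine Fin.addCases (fun i => ?_) (fun k => ?_) l
        · simp
        · simp
      have h := hCs.preimage_aeval (fun l : Fin (1 + (p + p)) =>
        (Fin.addCases (fun i => MvPolynomial.X i) (fun k => MvPolynomial.C (ab k)) l :
          MvPolynomial (Fin 1) ℝ))
      convert h using 1
      ext x
      rw [mem_setOf_eq, mem_preimage, heq x, hmemC]
    have hinf' : {t : ℝ | P (fun _ => t) ab}.Infinite := by
      intro hfin
      apply hinf
      refine (hfin.image fun t => fun _ : Fin 1 => t).subset fun x hx => ?_
      refine ⟨x 0, ?_, funext fun j => by rw [Subsingleton.elim j 0]⟩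
      have hx' : (fun _ : Fin 1 => x 0) = x := funext fun j => by rw [Subsingleton.elim j 0]
      show P (fun _ => x 0) ab
      rw [hx']
      exact hx
    have hsa : IsSemialgebraic ℝ {z : Fin 1 → ℝ | z 0 ∈ {t : ℝ | P (fun _ => t) ab}} := by
      convert hsaX using 1
      ext z
      have hz : (fun _ : Fin 1 => z 0) = z := funext fun j => by rw [Subsingleton.elim j 0]
      simp only [mem_setOf_eq, hz]
    obtain ⟨q₁, q₂, hq, hsub⟩ := exists_Ioo_subset_of_infinite hsa hinf'
    obtain ⟨t₀, ht₀⟩ : (Ioo q₁ q₂).Nonempty := nonempty_Ioo.mpr hq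
    obtain ⟨-, -, y₀, hy₀box, hy₀cl⟩ := hsub ht₀
    -- the open set `(q₁, q₂) × B(a, b)` misses `A`, hence its closure
    set U : Set (Fin (1 + p) → ℝ) := {z | z (Fin.castAdd p 0) ∈ Ioo q₁ q₂ ∧
      box ab fun j => z (Fin.natAdd 1 j)} with hU
    have hUopen : IsOpen U := by
      have h1 : IsOpen {z : Fin (1 + p) → ℝ | z (Fin.castAdd p 0) ∈ Ioo q₁ q₂} :=
        isOpen_Ioo.preimage (continuous_apply _)
      have h2 : IsOpen {z : Fin (1 + p) → ℝ | box ab fun j => z (Fin.natAdd 1 j)} := by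
        simp only [box, Set.setOf_forall]
        refine isOpen_iInter_of_finite fun i => ?_
        exact (isOpen_lt continuous_const (continuous_apply _)).inter
          (isOpen_lt (continuous_apply _) continuous_const)
      exact h1.inter h2
    have hUA : U ∩ A = ∅ := by
      refine eq_empty_of_forall_notMem fun z hz => ?_
      obtain ⟨⟨hz1, hz2⟩, hzA⟩ := hz
      have hP : P (fun _ : Fin 1 => z (Fin.castAdd p 0)) ab := hsub hz1
      have hx : (fun _ : Fin 1 => z (Fin.castAdd p 0)) = fun i : Fin 1 => z (Fin.castAdd p i) :=
        funext fun j => by rw [Subsingleton.elim j 0]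
      rw [hx] at hP
      exact hP.2.1 _ hz2 (by rw [hsplit z]; exact hzA)
    have hUcl : U ∩ closure A = ∅ := by
      refine subset_empty_iff.mp ?_
      calc U ∩ closure A ⊆ closure (U ∩ A) := hUopen.inter_closure
        _ = ∅ := by rw [hUA, closure_empty]
    have hmem : (Fin.append (fun _ : Fin 1 => t₀) y₀ : Fin (1 + p) → ℝ) ∈ U ∩ closure A := by
      refine ⟨⟨?_, ?_⟩, hy₀cl⟩
      · have : (Fin.append (fun _ : Fin 1 => t₀) y₀ : Fin (1 + p) → ℝ) (Fin.castAdd p 0) = t₀ :=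
          Fin.append_left _ _ 0
        rw [this]
        exact ht₀
      · intro i
        simp only [Fin.append_right]
        exact hy₀box i
    rw [hUcl] at hmem
    exact hmem
  -- claim 2: over a bad `x` the fibre of `C` has nonempty interior
  have hclaim2 : ∀ x : Fin 1 → ℝ, closure (fibre x A) \ fibre x A ≠ fibre x (closure A \ A) →
      (interior (fibre x C)).Nonempty := by
    intro x hx
    have hss : closure (fibre x A) \ fibre x A ⊂ fibre x (closure A \ A) :=
      (closure_fibre_diff_subset x A).ssubset_of_ne hx
    obtain ⟨y, hy, hyn⟩ := exists_of_ssubset hss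
    have hyA : y ∉ fibre x A := hy.2
    have hycl : y ∉ closure (fibre x A) := fun h => hyn ⟨h, hyA⟩
    rw [Metric.mem_closure_iff, not_forall] at hycl
    obtain ⟨δ, hδ⟩ := hycl
    rw [Classical.not_imp] at hδ
    obtain ⟨hδ, hfar⟩ := hδ
    push Not at hfar
    -- all small boxes around `y` lie in the fibre of `C`
    have hsub : {ab : Fin (p + p) → ℝ | ∀ i, y i - δ < ab (Fin.castAdd p i) ∧ ab (Fin.castAdd p i) < y i ∧
        y i < ab (Fin.natAdd p i) ∧ ab (Fin.natAdd p i) < y i + δ} ⊆ fibre x C := by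
      intro ab hab
      rw [hfibC]
      refine ⟨fun i => (hab i).2.1.trans (hab i).2.2.1, fun y' hy' hy'A => ?_, ⟨y, fun i => ⟨(hab i).2.1, (hab i).2.2.1⟩, hy.1⟩⟩
      have hdist : dist y' y < δ := by
        rw [dist_pi_lt_iff hδ]
        intro i
        rw [Real.dist_eq, abs_lt]
        have h1 := (hy' i).1
        have h2 := (hy' i).2
        have h3 := (hab i).1
        have h4 := (hab i).2.2.2
        constructor <;> linarith
      exact absurd (hfar y' hy'A) (not_le.mpr (by rw [dist_comm] at hdist; exact hdist))
    have hopen : IsOpen {ab : Fin (p + p) → ℝ | ∀ i, y i - δ < ab (Fin.castAdd p i) ∧ ab (Fin.castAdd p i) < y i ∧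
        y i < ab (Fin.natAdd p i) ∧ ab (Fin.natAdd p i) < y i + δ} := by
      simp only [Set.setOf_forall]
      refine isOpen_iInter_of_finite fun i => ?_
      refine ((isOpen_lt continuous_const (continuous_apply _)).inter ?_)
      refine (isOpen_lt (continuous_apply _) continuous_const).inter ?_
      exact (isOpen_lt continuous_const (continuous_apply _)).inter
        (isOpen_lt (continuous_apply _) continuous_const)
    have hne : (Fin.append (fun i => y i - δ / 2) (fun i => y i + δ / 2) : Fin (p + p) → ℝ) ∈
        {ab : Fin (p + p) → ℝ | ∀ i, y i - δ < ab (Fin.castAdd p i) ∧ ab (Fin.castAdd p i) < y i ∧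
          y i < ab (Fin.natAdd p i) ∧ ab (Fin.natAdd p i) < y i + δ} := by
      intro i
      simp only [Fin.append_left, Fin.append_right]
      refine ⟨by linarith, by linarith, by linarith, by linarith⟩
    exact ⟨_, interior_mono hsub (by rw [hopen.interior_eq]; exact hne)⟩
  -- the dimension count
  by_contra hbad
  rw [← Set.not_infinite, not_not] at hbad
  -- (α) lower bound: the bad `x` lie in `C(2p)`, which then contains an interval
  obtain ⟨hDs, hDdim⟩ := sdim_fibre_formula (m := 1) (n := p + p) hCs (p + p)
  set D : Set (Fin 1 → ℝ) := {a : Fin 1 → ℝ | (fibre a C).Nonempty ∧ sdim (fibre a C) = p + p} with hD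
  have hbadD : {x : Fin 1 → ℝ | closure (fibre x A) \ fibre x A ≠ fibre x (closure A \ A)} ⊆ D := by
    intro x hx
    have hint := hclaim2 x hx
    exact ⟨hint.mono interior_subset, sdim_eq_of_interior_nonempty hint⟩
  have hDinf : D.Infinite := hbad.mono hbadD
  have hD1 : 1 ≤ sdim D := by
    have hsa : IsSemialgebraic ℝ {z : Fin 1 → ℝ | z 0 ∈ {t : ℝ | (fun _ : Fin 1 => t) ∈ D}} := by
      convert hDs using 1
      ext z
      have hz : (fun _ : Fin 1 => z 0) = z := funext fun j => by rw [Subsingleton.elim j 0]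
      simp only [mem_setOf_eq, hz, hD]
    have hinf' : {t : ℝ | (fun _ : Fin 1 => t) ∈ D}.Infinite := by
      intro hfin
      apply hDinf
      refine (hfin.image fun t => fun _ : Fin 1 => t).subset fun x hx => ?_
      refine ⟨x 0, ?_, funext fun j => by rw [Subsingleton.elim j 0]⟩
      have hx' : (fun _ : Fin 1 => x 0) = x := funext fun j => by rw [Subsingleton.elim j 0]
      show (fun _ : Fin 1 => x 0) ∈ D
      rw [hx']
      exact hx
    obtain ⟨q₁, q₂, hq, hsub⟩ := exists_Ioo_subset_of_infinite hsa hinf'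
    refine one_le_sdim_of_Ioo_subset (0 : Fin 1) (fun _ => q₁) hq fun t ht => ?_
    have : Function.update (fun _ : Fin 1 => q₁) 0 t = fun _ => t :=
      funext fun j => by rw [Subsingleton.elim j 0]; simp
    rw [this]
    exact hsub ht
  have hlow : 1 + (p + p) ≤ sdim C := by
    have hDne : D.Nonempty := hDinf.nonempty
    have h := hDdim hDne
    calc 1 + (p + p) ≤ sdim D + (p + p) := by omega
      _ = sdim {z | z ∈ C ∧ (fibre (fun i => z (Fin.castAdd (p + p) i)) C).Nonempty ∧
            sdim (fibre (fun i => z (Fin.castAdd (p + p) i)) C) = p + p} := h.symm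
      _ ≤ sdim C := sdim_mono fun z hz => hz.1
  -- (β) upper bound: flip the coordinates; all fibres over `(a, b)` are finite
  set σ : Fin (p + p + 1) ≃ Fin (1 + (p + p)) := finAddFlip with hσ
  set C' : Set (Fin (p + p + 1) → ℝ) := (fun w : Fin (1 + (p + p)) → ℝ => w ∘ σ) '' C with hC'
  have hC's : IsSemialgebraic ℝ C' := hCs.image_comp σ
  have hdimC' : sdim C' = sdim C := sdim_image_eq_of_inverse hCs hC's (continuous_proj σ).continuousOn
    (isSemialgebraicMapOn_proj σ hCs) (continuous_proj σ.symm).continuousOn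
    (isSemialgebraicMapOn_proj σ.symm hC's) rfl (by
      rw [hC', image_image]
      convert image_id C using 2 with w
      funext l
      simp)
  have hmemC' : ∀ (ab : Fin (p + p) → ℝ) (x : Fin 1 → ℝ),
      (Fin.append ab x : Fin (p + p + 1) → ℝ) ∈ C' ↔ P x ab := by
    intro ab x
    rw [← hmemC]
    constructor
    · rintro ⟨w, hw, hwe⟩
      have hwe' : w ∘ σ = Fin.append ab x := hwe
      have : w = Fin.append x ab := by
        have h1 : w = (w ∘ σ) ∘ σ.symm := by funext l; simp
        rw [h1, hwe']
        funext l
        refine Fin.addCases (fun i => ?_) (fun k => ?_) l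
        · have hidx : σ.symm (Fin.castAdd (p + p) i) = Fin.natAdd (p + p) i := by
            rw [Equiv.symm_apply_eq, hσ, finAddFlip_apply_natAdd]
          simp [hidx]
        · have hidx : σ.symm (Fin.natAdd 1 k) = Fin.castAdd 1 k := by
            rw [Equiv.symm_apply_eq, hσ, finAddFlip_apply_castAdd]
          simp [hidx]
      rw [← this]
      exact hw
    · intro hw
      refine ⟨Fin.append x ab, hw, ?_⟩
      funext l
      refine Fin.addCases (fun k => ?_) (fun i => ?_) l
      · simp [hσ]
      · simp [hσ]
  have hfibC' : ∀ ab : Fin (p + p) → ℝ, fibre ab C' = {x : Fin 1 → ℝ | P x ab} := by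
    intro ab
    ext x
    rw [mem_fibre_iff, hmemC' ab x, mem_setOf_eq]
  obtain ⟨-, hEdim⟩ := sdim_fibre_formula (m := p + p) (n := 1) hC's 0
  have hall : {z | z ∈ C' ∧ (fibre (fun k => z (Fin.castAdd 1 k)) C').Nonempty ∧
      sdim (fibre (fun k => z (Fin.castAdd 1 k)) C') = 0} = C' := by
    ext z
    simp only [mem_setOf_eq, and_iff_left_iff_imp]
    intro hz
    have hne : (fibre (fun k => z (Fin.castAdd 1 k)) C').Nonempty := by
      refine ⟨fun j => z (Fin.natAdd (p + p) j), ?_⟩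
      rw [mem_fibre_iff, Fin.append_castAdd_natAdd]
      exact hz
    exact ⟨hne, by rw [hfibC']; exact sdim_eq_zero_of_finite (hclaim1 fun k => z (Fin.castAdd 1 k))⟩
  have hup : sdim C' ≤ p + p := by
    rcases ({a : Fin (p + p) → ℝ | (fibre a C').Nonempty ∧ sdim (fibre a C') = 0}).eq_empty_or_nonempty with h0 | hne
    · -- no nonempty fibres: `C'` is empty
      have : C' = ∅ := by
        rw [← hall]
        refine eq_empty_of_forall_notMem fun z hz => ?_
        have hmem : (fun k => z (Fin.castAdd 1 k)) ∈ {a : Fin (p + p) → ℝ | (fibre a C').Nonempty ∧ sdim (fibre a C') = 0} :=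
          ⟨hz.2.1, hz.2.2⟩
        rw [h0] at hmem
        exact hmem
      rw [this, sdim_empty]
      exact Nat.zero_le _
    · have h := hEdim hne
      rw [hall, add_zero] at h
      rw [h]
      exact sdim_le _
  rw [hdimC'] at hup
  omega

end FrontierLemma

/-! ## The frontier inequality [Dries1998, Ch. 4 (1.8)] -/

section FrontierTheorem

open Literature.NumberTheory.Transcendental.SemialgebraicMonotonicity

variable {m n : ℕ}

/-- `0`-cells are points. [cite: Dries1998, Ch. 4 (1.1)] -/
theorem IsSACell.subsingleton_of_zero {k : Type*} [CommRing k] [Algebra k ℝ] {p : ℕ}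
    {C : Set (Fin p → ℝ)} (h : IsSACell k p 0 C) : C.Subsingleton := by
  obtain ⟨ι, U, φ, -, -, hUeq, -, -, hleft, -⟩ := h.exists_chart
  intro x hx y hy
  have hxy : x ∘ ι = y ∘ ι := Subsingleton.elim _ _
  rw [← hleft x hx, ← hleft y hy, hxy]

/-- A semialgebraic set of dimension `0` is finite. [cite: Dries1998, Ch. 4 (1.1)] -/
theorem finite_of_sdim_eq_zero {p : ℕ} {S : Set (Fin p → ℝ)} (hS : IsSemialgebraic ℝ S)
    (h0 : sdim S = 0) : S.Finite := by
  classical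
  obtain ⟨𝒟, h𝒟, hadapt⟩ := IsSemialgebraic.exists_cylindricalDecomposition_holds (k := ℝ)
    ({S} : Finset (Set (Fin p → ℝ))) (by simpa using hS)
  obtain ⟨𝒞, h𝒞, hSeq⟩ := hadapt S (by simp)
  rw [← hSeq, sUnion_eq_biUnion]
  refine 𝒞.finite_toSet.biUnion fun C hC => ?_
  obtain ⟨d, hcell⟩ := h𝒟.exists_isSACell C (h𝒞 hC)
  have hd : d = 0 := by
    have := hcell.le_sdim_of_subset (hSeq ▸ subset_sUnion_of_mem hC)
    omega
  subst hd
  exact hcell.subsingleton_of_zero.finite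

/-- **Fibrewise domination of dimension** (the bookkeeping step of [Dries1998, Ch. 4 (1.8)],
from the fibre formula (1.5)): if every nonempty fibre `T_a` of `T ⊆ ℝᵐ × ℝⁿ` has smaller
dimension than the (nonempty) fibre `S_a`, then `T` is empty or `dim T < dim S`.
[cite: Dries1998, Ch. 4 (1.8), proof] -/
theorem sdim_lt_of_fibres {T S : Set (Fin (m + n) → ℝ)} (hT : IsSemialgebraic ℝ T)
    (hS : IsSemialgebraic ℝ S)
    (h : ∀ a, (fibre a T).Nonempty → (fibre a S).Nonempty ∧ sdim (fibre a T) < sdim (fibre a S)) :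
    T = ∅ ∨ sdim T < sdim S := by
  classical
  rcases T.eq_empty_or_nonempty with hTe | hTne
  · exact Or.inl hTe
  right
  -- the parts of `T` above `T(d)`, `d ≤ n`
  let Tpart : ℕ → Set (Fin (m + n) → ℝ) := fun d =>
    {z | z ∈ T ∧ (fibre (fun i => z (Fin.castAdd n i)) T).Nonempty ∧
      sdim (fibre (fun i => z (Fin.castAdd n i)) T) = d}
  let Td : ℕ → Set (Fin m → ℝ) := fun d => {a | (fibre a T).Nonempty ∧ sdim (fibre a T) = d}
  let Sd : ℕ → Set (Fin m → ℝ) := fun e => {a | (fibre a S).Nonempty ∧ sdim (fibre a S) = e}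
  let Spart : ℕ → Set (Fin (m + n) → ℝ) := fun e =>
    {z | z ∈ S ∧ (fibre (fun i => z (Fin.castAdd n i)) S).Nonempty ∧
      sdim (fibre (fun i => z (Fin.castAdd n i)) S) = e}
  have hTcover : T = ⋃ d ∈ Finset.range (n + 1), Tpart d := by
    ext z
    simp only [mem_iUnion, Finset.mem_range, exists_prop]
    constructor
    · intro hz
      have hne : (fibre (fun i => z (Fin.castAdd n i)) T).Nonempty :=
        ⟨fun j => z (Fin.natAdd m j), by rw [mem_fibre_iff, Fin.append_castAdd_natAdd]; exact hz⟩
      exact ⟨_, Nat.lt_succ_of_le (sdim_le _), hz, hne, rfl⟩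
    · rintro ⟨d, -, hz, -⟩
      exact hz
  -- each nonempty part has dimension `< sdim S`
  have hpart : ∀ d, (Tpart d).Nonempty → sdim (Tpart d) < sdim S := by
    intro d hne
    obtain ⟨hTds, hTdim⟩ := sdim_fibre_formula (m := m) (n := n) hT d
    have hTdne : (Td d).Nonempty := by
      obtain ⟨z, -, hz1, hz2⟩ := hne
      exact ⟨_, hz1, hz2⟩
    have heq : sdim (Tpart d) = sdim (Td d) + d := hTdim hTdne
    -- `T(d) ⊆ ⋃_{e > d} S(e)`
    have hsub : Td d ⊆ ⋃ e ∈ (Finset.range (n + 1)).filter (fun e => d < e ∧ (Sd e).Nonempty), Sd e := by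
      intro a ha
      obtain ⟨hSne, hlt⟩ := h a ha.1
      rw [ha.2] at hlt
      simp only [mem_iUnion, Finset.mem_filter, Finset.mem_range, exists_prop]
      exact ⟨sdim (fibre a S), ⟨Nat.lt_succ_of_le (sdim_le _), hlt, a, hSne, rfl⟩, hSne, rfl⟩
    set I := (Finset.range (n + 1)).filter (fun e => d < e ∧ (Sd e).Nonempty) with hI
    have hIne : I.Nonempty := by
      obtain ⟨a, ha⟩ := hTdne
      have := hsub ha
      simp only [mem_iUnion, exists_prop] at this
      obtain ⟨e, he, -⟩ := this
      exact ⟨e, he⟩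
    have hSds : ∀ e, IsSemialgebraic ℝ (Sd e) := fun e => (sdim_fibre_formula (m := m) (n := n) hS e).1
    have h1 : sdim (Td d) ≤ I.sup fun e => sdim (Sd e) :=
      (sdim_mono hsub).trans (sdim_biUnion_le I _ (fun e _ => hSds e) fun e he => Finset.le_sup (f := fun e => sdim (Sd e)) he)
    obtain ⟨e₀, he₀, hmax⟩ := Finset.exists_mem_eq_sup I hIne fun e => sdim (Sd e)
    obtain ⟨-, hde₀, hSdne⟩ := Finset.mem_filter.mp he₀
    have h2 : sdim (Spart e₀) = sdim (Sd e₀) + e₀ := (sdim_fibre_formula (m := m) (n := n) hS e₀).2 hSdne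
    have h3 : sdim (Spart e₀) ≤ sdim S := sdim_mono fun z hz => hz.1
    rw [heq]
    calc sdim (Td d) + d ≤ sdim (Sd e₀) + d := by rw [← hmax]; exact Nat.add_le_add_right h1 d
      _ < sdim (Sd e₀) + e₀ := Nat.add_lt_add_left hde₀ _
      _ = sdim (Spart e₀) := h2.symm
      _ ≤ sdim S := h3
  -- semialgebraicity of the parts and assembly
  have hparts : ∀ d, IsSemialgebraic ℝ (Tpart d) := by
    intro d
    obtain ⟨hTds, -⟩ := sdim_fibre_formula (m := m) (n := n) hT d
    have hpre : IsSemialgebraic ℝ {z : Fin (m + n) → ℝ | (fun i => z (Fin.castAdd n i)) ∈ Td d} :=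
      hTds.preimage_comp (Fin.castAdd n)
    have : Tpart d = T ∩ {z : Fin (m + n) → ℝ | (fun i => z (Fin.castAdd n i)) ∈ Td d} := by
      ext z
      simp only [Tpart, Td, mem_inter_iff, mem_setOf_eq]
    rw [this]
    exact hT.inter hpre
  have hpos : 0 < sdim S := by
    obtain ⟨z, hz⟩ := hTne
    set a : Fin m → ℝ := fun i => z (Fin.castAdd n i)
    have hne : (fibre a T).Nonempty :=
      ⟨fun j => z (Fin.natAdd m j), by rw [mem_fibre_iff, Fin.append_castAdd_natAdd]; exact hz⟩
    obtain ⟨hSne, hlt⟩ := h a hne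
    have h1 : sdim (fibre a S) ≤ sdim S := by
      have hT' : IsSemialgebraic ℝ ((fun y : Fin n → ℝ => (Fin.append a y : Fin (m + n) → ℝ)) '' fibre a S) :=
        Literature.NumberTheory.Transcendental.IsSemialgebraicMapOn.isSemialgebraic_image_holds
          (isSemialgebraicMapOn_append_const a (hS.fibre a)) subset_rfl (hS.fibre a)
      have himg : (fun w : Fin (m + n) → ℝ => w ∘ Fin.natAdd m) ''
          ((fun y : Fin n → ℝ => (Fin.append a y : Fin (m + n) → ℝ)) '' fibre a S) = fibre a S := by
        rw [image_image]
        convert image_id (fibre a S) using 2 with y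
        funext j
        simp
      have h2 := sdim_image_le hT' (continuous_proj (Fin.natAdd m)).continuousOn
        (isSemialgebraicMapOn_proj (Fin.natAdd m) hT')
      rw [himg] at h2
      refine h2.trans (sdim_mono ?_)
      rintro _ ⟨y, hy, rfl⟩
      exact hy
    omega
  rw [hTcover]
  refine lt_of_le_of_lt (sdim_biUnion_le _ _ (fun d _ => hparts d) (d := sdim S - 1) fun d _ => ?_) (by omega)
  rcases (Tpart d).eq_empty_or_nonempty with he | hne
  · rw [he, sdim_empty]
    exact Nat.zero_le _
  · have := hpart d hne
    omega


/-- Finite sets are semialgebraic. [cite: BochnakCosteRoy1998, §2.1] -/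
theorem _root_.Set.Finite.isSemialgebraic_real {p : ℕ} {S : Set (Fin p → ℝ)} (hS : S.Finite) :
    IsSemialgebraic ℝ S := by
  have h : S = ⋃ x ∈ hS.toFinset, {x} := by simp
  rw [h]
  refine IsSemialgebraic.biUnion _ _ fun x _ => ?_
  have : ({x} : Set (Fin p → ℝ)) = {z | ∀ i, z i = x i} := by
    ext z
    simp only [mem_singleton_iff, mem_setOf_eq]
    exact ⟨fun h i => by rw [h], fun h => funext h⟩
  rw [this]
  exact sa_fin_forall' fun i => sa_eq_const i (x i)

/-- Reindexing the coordinates along an equivalence preserves the dimension.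
[cite: Dries1998, Ch. 4 (1.3)(ii)] -/
theorem sdim_image_equivComp {a b : ℕ} (σ : Fin a ≃ Fin b) {S : Set (Fin b → ℝ)}
    (hS : IsSemialgebraic ℝ S) : sdim ((fun x : Fin b → ℝ => x ∘ σ) '' S) = sdim S := by
  have hT : IsSemialgebraic ℝ ((fun x : Fin b → ℝ => x ∘ σ) '' S) := hS.image_comp σ
  refine sdim_image_eq_of_inverse hS hT (continuous_proj σ).continuousOn
    (isSemialgebraicMapOn_proj σ hS) (continuous_proj σ.symm).continuousOn
    (isSemialgebraicMapOn_proj σ.symm hT) rfl ?_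
  rw [image_image]
  convert image_id S using 2 with x
  funext i
  simp

/-- Reindexing the coordinates commutes with closures and differences. [folklore] -/
theorem image_equivComp_closure_diff {a b : ℕ} (σ : Fin a ≃ Fin b) (S : Set (Fin b → ℝ)) :
    (fun x : Fin b → ℝ => x ∘ σ) '' (closure S \ S) =
      closure ((fun x : Fin b → ℝ => x ∘ σ) '' S) \ (fun x : Fin b → ℝ => x ∘ σ) '' S := by
  let L : (Fin b → ℝ) ≃L[ℝ] (Fin a → ℝ) := (LinearEquiv.funCongrLeft ℝ ℝ σ).toContinuousLinearEquiv
  have hL : ∀ x : Fin b → ℝ, L x = x ∘ σ := fun x => rfl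
  have himg : ∀ A : Set (Fin b → ℝ), (fun x : Fin b → ℝ => x ∘ σ) '' A = L.toHomeomorph '' A :=
    fun A => image_congr fun x _ => (hL x).symm
  rw [himg, himg, Set.image_sdiff L.toHomeomorph.injective, L.toHomeomorph.image_closure]

/-- **The frontier inequality** [Dries1998, Ch. 4 (1.8)]: for a nonempty semialgebraic
`S ⊆ ℝ^q`, the frontier `cl S ∖ S` is empty or has dimension `< dim S`. Proof as printed:
induction on `q` through Lemma (1.7) applied after moving each coordinate to the front, the
fibrewise domination `sdim_lt_of_fibres`, and finiteness of the exceptional hyperplane grid.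
[cite: Dries1998, Ch. 4 (1.8)] -/
theorem sdim_closure_diff_lt : ∀ (q : ℕ) {S : Set (Fin q → ℝ)}, IsSemialgebraic ℝ S →
    closure S \ S = ∅ ∨ sdim (closure S \ S) < sdim S := by
  intro q
  induction q with
  | zero =>
    intro S _
    left
    have : IsClosed S := (subsingleton_of_subsingleton (s := S)).isClosed
    rw [this.closure_eq, Set.sdiff_self]
  | succ q IH =>
    intro S hS
    classical
    rcases Nat.eq_zero_or_pos (sdim S) with h0 | hpos
    · left
      have hfin := finite_of_sdim_eq_zero hS h0
      rw [hfin.isClosed.closure_eq, Set.sdiff_self]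
    right
    set frS : Set (Fin (q + 1) → ℝ) := closure S \ S with hfrS
    have hfrSs : IsSemialgebraic ℝ frS := (isSemialgebraic_closure hS).diff hS
    -- move coordinate `i` to the front
    let e₀ : Fin (1 + q) ≃ Fin (q + 1) := finCongr (Nat.add_comm 1 q)
    let σ : Fin (q + 1) → (Fin (1 + q) ≃ Fin (q + 1)) := fun i =>
      e₀.trans (Equiv.swap (e₀ (Fin.castAdd q 0)) i)
    have hσ0 : ∀ i, σ i (Fin.castAdd q 0) = i := fun i => by simp [σ]
    let Φ : Fin (q + 1) → (Fin (q + 1) → ℝ) → (Fin (1 + q) → ℝ) := fun i z => z ∘ σ i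
    let Si : Fin (q + 1) → Set (Fin (1 + q) → ℝ) := fun i => Φ i '' S
    have hSis : ∀ i, IsSemialgebraic ℝ (Si i) := fun i => hS.image_comp (σ i)
    -- the exceptional values of Lemma (1.7)
    let F : Fin (q + 1) → Set (Fin 1 → ℝ) := fun i =>
      {x | closure (fibre x (Si i)) \ fibre x (Si i) ≠ fibre x (closure (Si i) \ Si i)}
    have hFfin : ∀ i, (F i).Finite := fun i => finite_setOf_frontier_fibre_ne (hSis i)
    -- the pieces
    let H : Set (Fin (q + 1) → ℝ) := {z | ∀ i, (fun _ : Fin 1 => z i) ∈ F i}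
    let Pc : Fin (q + 1) → Set (Fin (q + 1) → ℝ) := fun i => {z | z ∈ frS ∧ (fun _ : Fin 1 => z i) ∉ F i}
    have hcover : frS ⊆ H ∪ ⋃ i ∈ (Finset.univ : Finset (Fin (q + 1))), Pc i := by
      intro z hz
      by_cases h : ∀ i, (fun _ : Fin 1 => z i) ∈ F i
      · exact Or.inl h
      · push Not at h
        obtain ⟨i, hi⟩ := h
        refine Or.inr ?_
        simp only [mem_iUnion, Finset.mem_univ]
        exact ⟨i, trivial, ⟨hz, hi⟩⟩
    have hHfin : H.Finite := by
      have hpi : (Set.univ.pi fun i : Fin (q + 1) => F i).Finite := Set.Finite.pi fun i => hFfin i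
      have hH : H = (fun (z : Fin (q + 1) → ℝ) (i : Fin (q + 1)) => fun _ : Fin 1 => z i) ⁻¹'
          (Set.univ.pi fun i : Fin (q + 1) => F i) := by
        ext z
        simp [H]
      rw [hH]
      refine hpi.preimage fun z _ z' _ hzz' => ?_
      funext i
      have := congr_fun (congr_fun hzz' i) 0
      exact this
    have hHs : IsSemialgebraic ℝ H := hHfin.isSemialgebraic_real
    have hPcs : ∀ i, IsSemialgebraic ℝ (Pc i) := by
      intro i
      have h1 : IsSemialgebraic ℝ {z : Fin (q + 1) → ℝ | (fun _ : Fin 1 => z i) ∈ F i} := by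
        have : {z : Fin (q + 1) → ℝ | (fun _ : Fin 1 => z i) ∈ F i} = ⋃ x ∈ (hFfin i).toFinset, {z | z i = x 0} := by
          ext z
          simp only [mem_setOf_eq, mem_iUnion, Set.Finite.mem_toFinset, exists_prop]
          constructor
          · intro hz
            exact ⟨_, hz, rfl⟩
          · rintro ⟨x, hx, hzx⟩
            have : (fun _ : Fin 1 => z i) = x := funext fun j => by rw [hzx, Subsingleton.elim j 0]
            rw [this]
            exact hx
        rw [this]
        exact IsSemialgebraic.biUnion _ _ fun x _ => sa_eq_const i (x 0)
      exact hfrSs.inter h1.compl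
    -- each piece `Pc i` is empty or of dimension `< sdim S`
    have hPc : ∀ i, sdim (Pc i) < sdim S := by
      intro i
      set T : Set (Fin (1 + q) → ℝ) := Φ i '' Pc i with hT
      have hTs : IsSemialgebraic ℝ T := (hPcs i).image_comp (σ i)
      have hdimT : sdim T = sdim (Pc i) := sdim_image_equivComp (σ i) (hPcs i)
      have hdimSi : sdim (Si i) = sdim S := sdim_image_equivComp (σ i) hS
      have hfr : Φ i '' frS = closure (Si i) \ Si i := image_equivComp_closure_diff (σ i) S
      have hres := sdim_lt_of_fibres (m := 1) (n := q) hTs (hSis i) (fun x hx => ?_)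
      · rcases hres with he | hlt
        · have : Pc i = ∅ := by
            rw [hT, image_eq_empty] at he
            exact he
          rw [this, sdim_empty]
          exact hpos
        · rw [hdimT, hdimSi] at hlt
          exact hlt
      -- the fibre hypothesis, from Lemma (1.7) and the induction hypothesis
      obtain ⟨y, hy⟩ := hx
      rw [mem_fibre_iff, hT] at hy
      obtain ⟨z, hz, hzy⟩ := hy
      have hx0 : x = fun _ : Fin 1 => z i := by
        funext j
        rw [Subsingleton.elim j 0]
        have h1 := congr_fun hzy (Fin.castAdd q 0)
        simp only [Fin.append_left] at h1
        rw [← h1]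
        show z (σ i (Fin.castAdd q 0)) = z i
        rw [hσ0]
      have hxF : x ∉ F i := hx0 ▸ hz.2
      have hgood : closure (fibre x (Si i)) \ fibre x (Si i) = fibre x (closure (Si i) \ Si i) := by
        by_contra h
        exact hxF h
      have hsub : fibre x T ⊆ closure (fibre x (Si i)) \ fibre x (Si i) := by
        intro y' hy'
        rw [hgood, mem_fibre_iff, ← hfr]
        rw [mem_fibre_iff, hT] at hy'
        obtain ⟨z', hz', hz'y⟩ := hy'
        exact ⟨z', hz'.1, hz'y⟩
      have hne : (closure (fibre x (Si i)) \ fibre x (Si i)).Nonempty := ⟨y, hsub (by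
        rw [mem_fibre_iff, hT]; exact ⟨z, hz, hzy⟩)⟩
      have hfibne : (fibre x (Si i)).Nonempty := by
        by_contra h
        rw [not_nonempty_iff_eq_empty] at h
        rw [h, closure_empty, Set.sdiff_self] at hne
        exact not_nonempty_empty hne
      refine ⟨hfibne, ?_⟩
      rcases IH ((hSis i).fibre x) with he | hlt
      · rw [he] at hne
        exact absurd hne not_nonempty_empty
      · exact (sdim_mono hsub).trans_lt hlt
    -- assemble
    have hHdim : sdim H < sdim S := by
      rw [sdim_eq_zero_of_finite hHfin]
      exact hpos
    calc sdim frS ≤ sdim (H ∪ ⋃ i ∈ (Finset.univ : Finset (Fin (q + 1))), Pc i) := sdim_mono hcover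
      _ = max (sdim H) (sdim (⋃ i ∈ (Finset.univ : Finset (Fin (q + 1))), Pc i)) :=
          sdim_union hHs (IsSemialgebraic.biUnion _ _ fun i _ => hPcs i)
      _ < sdim S := max_lt hHdim (lt_of_le_of_lt (sdim_biUnion_le _ _ (fun i _ => hPcs i)
          (d := sdim S - 1) fun i _ => by have := hPc i; omega) (by omega))

/-- **The frontier inequality**, nonempty-frontier form: `dim (cl S ∖ S) < dim S` whenever the
frontier is nonempty. [cite: Dries1998, Ch. 4 (1.8)] -/
theorem sdim_closure_diff_lt' {q : ℕ} {S : Set (Fin q → ℝ)} (hS : IsSemialgebraic ℝ S)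
    (hne : (closure S \ S).Nonempty) : sdim (closure S \ S) < sdim S := by
  rcases sdim_closure_diff_lt q hS with h | h
  · rw [h] at hne
    exact absurd hne not_nonempty_empty
  · exact h

end FrontierTheorem

/-! ## Stratifications [Dries1998, Ch. 4 (1.9), (1.11)–(1.16)] -/

section Stratification

open Literature.NumberTheory.Transcendental.SemialgebraicMonotonicity

variable {n : ℕ}

/-- **Corollary (1.9)** of the frontier inequality: if `S ⊆ T` have the same dimension, the
points of `S` adherent to `T ∖ S` form a set of smaller dimension (or `S` is open in `T`).
[cite: Dries1998, Ch. 4 (1.9)] -/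
theorem sdim_inter_closure_diff_lt {S T : Set (Fin n → ℝ)} (hS : IsSemialgebraic ℝ S)
    (hT : IsSemialgebraic ℝ T) (hdim : sdim S = sdim T) :
    S ∩ closure (T \ S) = ∅ ∨ sdim (S ∩ closure (T \ S)) < sdim S := by
  have hsub : S ∩ closure (T \ S) ⊆ closure (T \ S) \ (T \ S) := fun x hx =>
    ⟨hx.2, fun h => h.2 hx.1⟩
  rcases (S ∩ closure (T \ S)).eq_empty_or_nonempty with h | hne
  · exact Or.inl h
  right
  have hfr : (closure (T \ S) \ (T \ S)).Nonempty := hne.mono hsub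
  calc sdim (S ∩ closure (T \ S)) ≤ sdim (closure (T \ S) \ (T \ S)) := sdim_mono hsub
    _ < sdim (T \ S) := sdim_closure_diff_lt' (hT.diff hS) hfr
    _ ≤ sdim T := sdim_mono Set.sdiff_subset
    _ = sdim S := hdim.symm

/-- A band over any set, cut out by sections continuous on it, is relatively open in the cylinder
over the set. [cite: Dries1998, Ch. 3 (2.3)] -/
theorem exists_isOpen_bandOver_eq {l : ℕ} (S : Set (Fin n → ℝ)) {ξ : Fin l → (Fin n → ℝ) → ℝ}
    (hξ : ∀ i, ContinuousOn (ξ i) S) (j : Fin (l + 1)) :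
    ∃ W : Set (Fin (n + 1) → ℝ), IsOpen W ∧
      bandOver S ξ j = {z : Fin (n + 1) → ℝ | Fin.init z ∈ S} ∩ W := by
  set A : Set (Fin (n + 1) → ℝ) := {z | Fin.init z ∈ S} with hA
  have hlast : Continuous fun z : Fin (n + 1) → ℝ => z (Fin.last n) := continuous_apply _
  have hsec : ∀ i, ContinuousOn (fun z : Fin (n + 1) → ℝ => ξ i (Fin.init z)) A := fun i =>
    (hξ i).comp continuous_id.finInit.continuousOn fun z hz => hz
  -- lower condition
  have hlow : ∃ W₁ : Set (Fin (n + 1) → ℝ), IsOpen W₁ ∧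
      {z ∈ A | bandLower ξ j (Fin.init z) < (z (Fin.last n) : EReal)} = A ∩ W₁ := by
    by_cases h0 : j = 0
    · subst h0
      refine ⟨univ, isOpen_univ, ?_⟩
      ext z
      simp [hA]
    · obtain ⟨u, hu, hueq⟩ := (continuousOn_iff'.mp (hlast.continuousOn.sub (hsec (j.pred h0))))
        (Ioi 0) isOpen_Ioi
      refine ⟨u, hu, ?_⟩
      rw [Set.inter_comm A u, ← hueq]
      ext z
      simp only [mem_setOf_eq, mem_inter_iff, mem_preimage, mem_Ioi, Pi.sub_apply,
        bandLower_of_ne_zero ξ j h0, EReal.coe_lt_coe_iff, sub_pos]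
      tauto
  have hup : ∃ W₂ : Set (Fin (n + 1) → ℝ), IsOpen W₂ ∧
      {z ∈ A | (z (Fin.last n) : EReal) < bandUpper ξ j (Fin.init z)} = A ∩ W₂ := by
    by_cases hl : j = Fin.last l
    · subst hl
      refine ⟨univ, isOpen_univ, ?_⟩
      ext z
      simp [hA]
    · obtain ⟨u, hu, hueq⟩ := (continuousOn_iff'.mp ((hsec (j.castPred hl)).sub hlast.continuousOn))
        (Ioi 0) isOpen_Ioi
      refine ⟨u, hu, ?_⟩
      rw [Set.inter_comm A u, ← hueq]
      ext z
      simp only [mem_setOf_eq, mem_inter_iff, mem_preimage, mem_Ioi, Pi.sub_apply,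
        bandUpper_of_ne_last ξ j hl, EReal.coe_lt_coe_iff, sub_pos]
      tauto
  obtain ⟨W₁, hW₁, h₁⟩ := hlow
  obtain ⟨W₂, hW₂, h₂⟩ := hup
  refine ⟨W₁ ∩ W₂, hW₁.inter hW₂, ?_⟩
  have hset : bandOver S ξ j = {z ∈ A | bandLower ξ j (Fin.init z) < (z (Fin.last n) : EReal)} ∩
      {z ∈ A | (z (Fin.last n) : EReal) < bandUpper ξ j (Fin.init z)} := by
    ext z
    simp only [mem_bandOver_iff, mem_inter_iff, hA, mem_setOf_eq]
    tauto
  rw [hset, h₁, h₂]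
  ext z
  simp only [mem_inter_iff]
  tauto

/-- The fibre of a band over a base point contains an open interval around any of its points.
[cite: Dries1998, Ch. 3 (2.3)] -/
theorem exists_Ioo_snoc_mem_bandOver {l : ℕ} {S : Set (Fin n → ℝ)} {ξ : Fin l → (Fin n → ℝ) → ℝ}
    {j : Fin (l + 1)} {x : Fin n → ℝ} {t : ℝ} (h : (Fin.snoc x t : Fin (n + 1) → ℝ) ∈ bandOver S ξ j) :
    ∃ ε > 0, ∀ t' ∈ Ioo (t - ε) (t + ε), (Fin.snoc x t' : Fin (n + 1) → ℝ) ∈ bandOver S ξ j := by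
  rw [snoc_mem_bandOver_iff] at h
  have hopen : IsOpen {t' : ℝ | bandLower ξ j x < (t' : EReal) ∧ (t' : EReal) < bandUpper ξ j x} :=
    (isOpen_lt continuous_const continuous_coe_real_ereal).inter
      (isOpen_lt continuous_coe_real_ereal continuous_const)
  obtain ⟨ε, hε, hball⟩ := Metric.isOpen_iff.mp hopen t ⟨h.2.1, h.2.2⟩
  refine ⟨ε, hε, fun t' ht' => ?_⟩
  rw [snoc_mem_bandOver_iff]
  have : t' ∈ Metric.ball t ε := by
    rw [Metric.mem_ball, Real.dist_eq, abs_lt]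
    constructor <;> linarith [ht'.1, ht'.2]
  exact ⟨h.1, (hball this).1, (hball this).2⟩

/-- **Lemma (1.14)**: a cell contained in a cell of the same dimension is (relatively) open in
it. [cite: Dries1998, Ch. 4 (1.14)] -/
theorem IsSACell.exists_isOpen_eq_inter :
    ∀ (n : ℕ) {d : ℕ} {C D : Set (Fin n → ℝ)}, IsSACell ℝ n d C → IsSACell ℝ n d D → D ⊆ C →
      ∃ U : Set (Fin n → ℝ), IsOpen U ∧ D = C ∩ U := by
  intro n
  induction n with
  | zero =>
    intro d C D hC hD hDC
    refine ⟨univ, isOpen_univ, ?_⟩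
    cases hC
    cases hD
    simp
  | succ n IH =>
    intro d C D hC hD hDC
    cases hC with
    | @graph _ dC SC f hSC hfc hfs =>
      cases hD with
      | @graph _ dD SD g hSD hgc hgs =>
        -- graph in graph: compare the bases
        have hSDC : SD ⊆ SC := fun x hx => by
          have := hDC (show (Fin.snoc x (g x) : Fin (n + 1) → ℝ) ∈ graphOver SD g by simp [hx])
          exact (snoc_mem_graphOver_iff.mp this).1
        have hfg : ∀ x ∈ SD, g x = f x := fun x hx => by
          have := hDC (show (Fin.snoc x (g x) : Fin (n + 1) → ℝ) ∈ graphOver SD g by simp [hx])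
          exact (snoc_mem_graphOver_iff.mp this).2
        obtain ⟨U', hU', hSDeq⟩ := IH hSC hSD hSDC
        refine ⟨{z | Fin.init z ∈ U'}, hU'.preimage continuous_id.finInit, ?_⟩
        ext z
        simp only [mem_graphOver_iff, mem_inter_iff, mem_setOf_eq]
        constructor
        · rintro ⟨hzS, hzg⟩
          have hx : Fin.init z ∈ SC ∩ U' := hSDeq ▸ hzS
          exact ⟨⟨hx.1, by rw [hzg, hfg _ hzS]⟩, hx.2⟩
        · rintro ⟨⟨hzS, hzf⟩, hzU⟩
          have hx : Fin.init z ∈ SD := by rw [hSDeq]; exact ⟨hzS, hzU⟩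
          exact ⟨hx, by rw [hzf, hfg _ hx]⟩
      | @band _ dD l SD ζ j hSD hζc hζs hζm =>
        -- a band cannot lie in a graph
        exfalso
        obtain ⟨x, hx⟩ := hSD.nonempty
        obtain ⟨m, -, hm⟩ := exists_continuousOn_snoc_mem_bandOver hζc hζm j
        obtain ⟨ε, hε, hI⟩ := exists_Ioo_snoc_mem_bandOver (hm x hx)
        have h1 := hDC (hI (m x) ⟨by linarith, by linarith⟩)
        have h2 := hDC (hI (m x + ε / 2) ⟨by linarith, by linarith⟩)
        rw [snoc_mem_graphOver_iff] at h1 h2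
        linarith [h1.2, h2.2]
    | @band _ dC l SC ξ j hSC hξc hξs hξm =>
      cases hD with
      | @graph _ dD SD g hSD hgc hgs =>
        -- a graph of full dimension cannot lie in a band: dimension count on the bases
        exfalso
        have hSDC : SD ⊆ SC := fun x hx => by
          have := hDC (show (Fin.snoc x (g x) : Fin (n + 1) → ℝ) ∈ graphOver SD g by simp [hx])
          exact (snoc_mem_bandOver_iff.mp this).1
        have h1 := hSD.le_sdim_of_subset hSDC
        rw [hSC.sdim_eq] at h1
        omega
      | @band _ dD l' SD ζ j' hSD hζc hζs hζm =>
        have hSDC : SD ⊆ SC := fun x hx => by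
          obtain ⟨m, -, hm⟩ := exists_continuousOn_snoc_mem_bandOver hζc hζm j'
          exact (snoc_mem_bandOver_iff.mp (hDC (hm x hx))).1
        obtain ⟨U', hU', hSDeq⟩ := IH hSC hSD hSDC
        obtain ⟨W, hW, hDeq⟩ := exists_isOpen_bandOver_eq SD hζc j'
        refine ⟨{z | Fin.init z ∈ U'} ∩ W, (hU'.preimage continuous_id.finInit).inter hW, ?_⟩
        apply Subset.antisymm
        · intro z hz
          have hz' := hz
          rw [hDeq] at hz'
          have hx : Fin.init z ∈ SC ∩ U' := hSDeq ▸ hz'.1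
          exact ⟨hDC hz, hx.2, hz'.2⟩
        · rintro z ⟨hzC, hzU, hzW⟩
          rw [hDeq]
          refine ⟨?_, hzW⟩
          show Fin.init z ∈ SD
          rw [hSDeq]
          exact ⟨hzC.1, hzU⟩

/-- Singletons are real `0`-cells. [cite: Dries1998, Ch. 3 (2.3)] -/
theorem isSACell_singleton :
    ∀ (n : ℕ) (a : Fin n → ℝ), IsSACell ℝ n 0 {a} := by
  intro n
  induction n with
  | zero =>
    intro a
    have : ({a} : Set (Fin 0 → ℝ)) = univ := eq_univ_of_forall fun x => Subsingleton.elim _ _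
    rw [this]
    exact IsSACell.zero
  | succ n IH =>
    intro a
    have hs : IsSemialgebraicFunOn ℝ ({Fin.init a} : Set (Fin n → ℝ)) fun _ => a (Fin.last n) := by
      simpa using isSemialgebraicFunOn_algebraMap (k := ℝ)
        (IsSACell.isSemialgebraic (IH (Fin.init a))) (a (Fin.last n))
    have h := (IH (Fin.init a)).graph (f := fun _ => a (Fin.last n)) continuousOn_const hs
    convert h using 1
    ext z
    simp only [mem_singleton_iff, mem_graphOver_iff]
    constructor
    · rintro rfl
      exact ⟨rfl, rfl⟩
    · rintro ⟨h1, h2⟩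
      replace h1 : Fin.init z = Fin.init a := h1
      rw [← Fin.snoc_init_self z, ← Fin.snoc_init_self a, h1, h2]


/-- Distinct cells of a cylindrical decomposition are disjoint. [cite: BasuPollackRoy2006, Def. 5.1] -/
theorem IsCylindricalDecomposition.disjoint_of_ne {k : Type*} [CommRing k] [Algebra k ℝ]
    {𝒟 : Finset (Set (Fin n → ℝ))} (h𝒟 : IsCylindricalDecomposition k n 𝒟)
    {C C' : Set (Fin n → ℝ)} (hC : C ∈ 𝒟) (hC' : C' ∈ 𝒟) (hne : C ≠ C') : Disjoint C C' :=
  h𝒟.isPartition.pairwiseDisjoint hC hC' hne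

/-- Cells of a decomposition adapted to `B` lie in `B` or miss it. [cite: BasuPollackRoy2006, Def. 5.1] -/
theorem IsCylindricalDecomposition.subset_or_disjoint {k : Type*} [CommRing k] [Algebra k ℝ]
    {𝒟 : Finset (Set (Fin n → ℝ))} (h𝒟 : IsCylindricalDecomposition k n 𝒟)
    {B : Set (Fin n → ℝ)} (hB : ∃ 𝒞 ⊆ 𝒟, ⋃₀ (𝒞 : Set (Set (Fin n → ℝ))) = B)
    {C : Set (Fin n → ℝ)} (hC : C ∈ 𝒟) : C ⊆ B ∨ Disjoint C B := by
  classical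
  obtain ⟨𝒞, h𝒞, hBeq⟩ := hB
  by_cases h : C ∈ 𝒞
  · exact Or.inl (hBeq ▸ subset_sUnion_of_mem h)
  · right
    rw [← hBeq, disjoint_sUnion_right]
    intro C' hC'
    exact h𝒟.disjoint_of_ne hC (h𝒞 hC') fun heq => h (heq ▸ hC')

/-- **Lemma (1.15)**: a top-dimensional cell `C ⊆ A` contains finitely many disjoint cells of
the same dimension, each open in `A`, covering `C` up to a set of smaller dimension.
[cite: Dries1998, Ch. 4 (1.15)] -/
theorem exists_cells_isOpen_in {A C : Set (Fin n → ℝ)} (hA : IsSemialgebraic ℝ A) {d : ℕ}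
    (hC : IsSACell ℝ n d C) (hCA : C ⊆ A) (hdim : sdim A = d) :
    ∃ 𝒟 : Finset (Set (Fin n → ℝ)),
      (∀ D ∈ 𝒟, D ⊆ C ∧ IsSACell ℝ n d D ∧ ∃ U : Set (Fin n → ℝ), IsOpen U ∧ D = A ∩ U) ∧
      (∀ D ∈ 𝒟, ∀ D' ∈ 𝒟, D ≠ D' → Disjoint D D') ∧
      (C \ ⋃ D ∈ 𝒟, D = ∅ ∨ sdim (C \ ⋃ D ∈ 𝒟, D) < d) := by
  classical
  have hCs : IsSemialgebraic ℝ C := hC.isSemialgebraic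
  -- the interior of `C` in `A`
  set W : Set (Fin n → ℝ) := C \ closure (A \ C) with hW
  have hWs : IsSemialgebraic ℝ W := hCs.diff (isSemialgebraic_closure (hA.diff hCs))
  have h19 := sdim_inter_closure_diff_lt hCs hA (by rw [hC.sdim_eq, hdim])
  obtain ⟨Pcad, hPcad, hadapt⟩ := IsSemialgebraic.exists_cylindricalDecomposition_holds (k := ℝ)
    ({W} : Finset (Set (Fin n → ℝ))) (by simpa using hWs)
  obtain ⟨𝒞, h𝒞, hWeq⟩ := hadapt W (by simp)
  set 𝒟 : Finset (Set (Fin n → ℝ)) := 𝒞.filter fun D => IsSACell ℝ n d D with h𝒟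
  have hDW : ∀ D ∈ 𝒟, D ⊆ W := fun D hD =>
    hWeq ▸ subset_sUnion_of_mem (Finset.mem_filter.mp hD).1
  refine ⟨𝒟, fun D hD => ?_, fun D hD D' hD' hne => ?_, ?_⟩
  · obtain ⟨hD𝒞, hcell⟩ := Finset.mem_filter.mp hD
    have hDC : D ⊆ C := (hDW D hD).trans Set.sdiff_subset
    refine ⟨hDC, hcell, ?_⟩
    obtain ⟨U, hU, hDeq⟩ := IsSACell.exists_isOpen_eq_inter n hC hcell hDC
    refine ⟨U \ closure (A \ C), hU.sdiff isClosed_closure, ?_⟩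
    apply Subset.antisymm
    · intro z hz
      exact ⟨hCA (hDC hz), (hDeq ▸ hz : z ∈ C ∩ U).2, (hDW D hD hz).2⟩
    · rintro z ⟨hzA, hzU, hzcl⟩
      have hzC : z ∈ C := by
        by_contra h
        exact hzcl (subset_closure ⟨hzA, h⟩)
      rw [hDeq]
      exact ⟨hzC, hzU⟩
  · exact hPcad.disjoint_of_ne (h𝒞 (Finset.mem_filter.mp hD).1) (h𝒞 (Finset.mem_filter.mp hD').1) hne
  · -- the remainder lies in `(C ∩ cl (A ∖ C)) ∪ ⋃ (cells of W of dimension < d)`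
    set Lw : Finset (Set (Fin n → ℝ)) := 𝒞.filter fun D => ¬ IsSACell ℝ n d D with hLw
    have hrem : C \ ⋃ D ∈ 𝒟, D ⊆ (C ∩ closure (A \ C)) ∪ ⋃ E ∈ Lw, E := by
      intro z hz
      obtain ⟨hzC, hzD⟩ := hz
      by_cases hzW : z ∈ W
      · right
        rw [← hWeq] at hzW
        obtain ⟨E, hE, hzE⟩ := mem_sUnion.mp hzW
        have hE' : E ∈ Lw := by
          refine Finset.mem_filter.mpr ⟨hE, fun hcell => hzD ?_⟩
          exact mem_biUnion (Finset.mem_filter.mpr ⟨hE, hcell⟩) hzE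
        exact mem_biUnion hE' hzE
      · left
        refine ⟨hzC, ?_⟩
        by_contra h
        exact hzW ⟨hzC, h⟩
    have hLwdim : ∀ E ∈ Lw, sdim E < d := by
      intro E hE
      obtain ⟨hE𝒞, hnot⟩ := Finset.mem_filter.mp hE
      obtain ⟨e, hcell⟩ := hPcad.exists_isSACell E (h𝒞 hE𝒞)
      have hle : e ≤ d := by
        have := hcell.le_sdim_of_subset ((hWeq ▸ subset_sUnion_of_mem hE𝒞 : E ⊆ W).trans
          Set.sdiff_subset)
        rwa [hC.sdim_eq] at this
      have hne : e ≠ d := fun h => hnot (h ▸ hcell)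
      rw [hcell.sdim_eq]
      omega
    have hLws : ∀ E ∈ Lw, IsSemialgebraic ℝ E := fun E hE =>
      hPcad.isSemialgebraic E (h𝒞 (Finset.mem_filter.mp hE).1)
    rcases Nat.eq_zero_or_pos d with hd0 | hdpos
    · -- `d = 0`: everything of dimension `< 0` is empty
      left
      refine subset_empty_iff.mp (hrem.trans ?_)
      refine union_subset ?_ ?_
      · rcases h19 with h | h
        · rw [h]
        · rw [hC.sdim_eq] at h
          omega
      · refine iUnion₂_subset fun E hE => ?_
        have := hLwdim E hE
        omega
    · right
      have hpieces : sdim ((C ∩ closure (A \ C)) ∪ ⋃ E ∈ Lw, E) ≤ d - 1 := by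
        rw [sdim_union (hCs.inter (isSemialgebraic_closure (hA.diff hCs)))
          (IsSemialgebraic.biUnion _ _ hLws)]
        refine max_le ?_ (sdim_biUnion_le _ _ hLws fun E hE => by have := hLwdim E hE; omega)
        rcases h19 with h | h
        · rw [h, sdim_empty]
          exact Nat.zero_le _
        · rw [hC.sdim_eq] at h
          omega
      have := sdim_mono hrem
      omega


/-- **Stratifications** [Dries1998, Ch. 4 (1.11)]: a finite partition of `A` into (real
semialgebraic) cells such that the frontier `cl S ∖ S` of each stratum lies in `A` and is a union of
strata (loc. cit. assumes `A` closed, which makes the first requirement automatic).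
[cite: Dries1998, Ch. 4 (1.11)] -/
def IsSAStratification (𝔖 : Finset (Set (Fin n → ℝ))) (A : Set (Fin n → ℝ)) : Prop :=
  (∀ S ∈ 𝔖, ∃ d, IsSACell ℝ n d S) ∧ ⋃₀ (𝔖 : Set (Set (Fin n → ℝ))) = A ∧
    (∀ S ∈ 𝔖, ∀ S' ∈ 𝔖, S ≠ S' → Disjoint S S') ∧
    (∀ S ∈ 𝔖, closure S \ S ⊆ A) ∧
    ∀ S ∈ 𝔖, ∀ S' ∈ 𝔖, (S' ∩ (closure S \ S)).Nonempty → S' ⊆ closure S \ S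

/-- **Existence of stratifications** [Dries1998, Ch. 4 (1.13)]: a closed semialgebraic set
admits a stratification partitioning any given finitely many semialgebraic sets. Proof as
printed ((1.16)): induction on `dim A`, keeping the top-dimensional cells that are open in `A`
((1.15)) and stratifying the closed lower-dimensional remainder compatibly with their frontiers.
[cite: Dries1998, Ch. 4 (1.13)] -/
theorem exists_stratification :
    ∀ (e : ℕ) {A : Set (Fin n → ℝ)}, IsSemialgebraic ℝ A → IsClosed A → sdim A ≤ e →
      ∀ 𝒜 : Finset (Set (Fin n → ℝ)), (∀ B ∈ 𝒜, IsSemialgebraic ℝ B) →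
        ∃ 𝔖 : Finset (Set (Fin n → ℝ)), IsSAStratification 𝔖 A ∧
          ∀ S ∈ 𝔖, ∀ B ∈ 𝒜, S ⊆ B ∨ Disjoint S B := by
  intro e
  induction e with
  | zero =>
    -- `dim A = 0`: `A` is finite, its points are the strata
    intro A hA _ hdim 𝒜 _
    classical
    have hfin : A.Finite := finite_of_sdim_eq_zero hA (Nat.le_zero.mp hdim)
    refine ⟨hfin.toFinset.image fun a => ({a} : Set (Fin n → ℝ)), ⟨?_, ?_, ?_, ?_, ?_⟩, ?_⟩
    · intro S hS
      obtain ⟨a, -, rfl⟩ := Finset.mem_image.mp hS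
      exact ⟨0, isSACell_singleton n a⟩
    · ext x
      simp only [mem_sUnion, Finset.coe_image, mem_image, Finset.mem_coe, Set.Finite.mem_toFinset]
      constructor
      · rintro ⟨_, ⟨a, ha, rfl⟩, hx⟩
        rw [mem_singleton_iff] at hx
        exact hx ▸ ha
      · intro hx
        exact ⟨{x}, ⟨x, hx, rfl⟩, mem_singleton x⟩
    · intro S hS S' hS' hne
      obtain ⟨a, -, rfl⟩ := Finset.mem_image.mp hS
      obtain ⟨a', -, rfl⟩ := Finset.mem_image.mp hS'
      exact disjoint_singleton.mpr fun h => hne (by rw [h])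
    · intro S hS
      obtain ⟨a, -, rfl⟩ := Finset.mem_image.mp hS
      rw [closure_singleton, Set.sdiff_self]
      exact empty_subset _
    · intro S hS S' _ hne'
      obtain ⟨a, -, rfl⟩ := Finset.mem_image.mp hS
      rw [closure_singleton, Set.sdiff_self, inter_empty] at hne'
      exact absurd hne' not_nonempty_empty
    · intro S hS B _
      obtain ⟨a, -, rfl⟩ := Finset.mem_image.mp hS
      by_cases h : a ∈ B
      · exact Or.inl (singleton_subset_iff.mpr h)
      · exact Or.inr (disjoint_singleton_left.mpr h)
  | succ e IH =>
    intro A hA hAc hdim 𝒜 h𝒜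
    classical
    -- if `dim A ≤ e` we are done by induction
    rcases Nat.lt_or_ge (sdim A) (e + 1) with hlt | hge
    · exact IH hA hAc (Nat.lt_succ_iff.mp hlt) 𝒜 h𝒜
    have hdA : sdim A = e + 1 := le_antisymm hdim hge
    -- a cell decomposition of `A` partitioning each `B ∈ 𝒜`
    obtain ⟨Pcad, hP, hadapt⟩ := IsSemialgebraic.exists_cylindricalDecomposition_holds (k := ℝ)
      (insert A 𝒜) (by
        intro B hB
        rcases Finset.mem_insert.mp hB with rfl | hB
        · exact hA
        · exact h𝒜 B hB)
    obtain ⟨𝒞, h𝒞, hAeq⟩ := hadapt A (Finset.mem_insert_self A 𝒜)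
    have h𝒞B : ∀ C ∈ 𝒞, ∀ B ∈ 𝒜, C ⊆ B ∨ Disjoint C B := fun C hC B hB =>
      hP.subset_or_disjoint (hadapt B (Finset.mem_insert_of_mem hB)) (h𝒞 hC)
    have h𝒞A : ∀ C ∈ 𝒞, C ⊆ A := fun C hC => hAeq ▸ subset_sUnion_of_mem hC
    -- top-dimensional cells and their open-in-`A` subcells (1.15)
    set 𝒞top : Finset (Set (Fin n → ℝ)) := 𝒞.filter fun C => IsSACell ℝ n (e + 1) C with h𝒞top
    have htop : ∀ C ∈ 𝒞top, ∃ 𝒟 : Finset (Set (Fin n → ℝ)),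
        (∀ D ∈ 𝒟, D ⊆ C ∧ IsSACell ℝ n (e + 1) D ∧ ∃ U : Set (Fin n → ℝ), IsOpen U ∧ D = A ∩ U) ∧
        (∀ D ∈ 𝒟, ∀ D' ∈ 𝒟, D ≠ D' → Disjoint D D') ∧
        (C \ ⋃ D ∈ 𝒟, D = ∅ ∨ sdim (C \ ⋃ D ∈ 𝒟, D) < e + 1) := fun C hC =>
      exists_cells_isOpen_in hA (Finset.mem_filter.mp hC).2 (h𝒞A C (Finset.mem_filter.mp hC).1) hdA
    choose! 𝒟f h𝒟f h𝒟disj h𝒟rem using htop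
    set Ptop : Finset (Set (Fin n → ℝ)) := 𝒞top.biUnion 𝒟f with hPtop
    have hPtop_mem : ∀ D ∈ Ptop, ∃ C ∈ 𝒞top, D ∈ 𝒟f C := fun D hD => by
      simpa [hPtop] using hD
    have hPtopA : ∀ D ∈ Ptop, D ⊆ A := fun D hD => by
      obtain ⟨C, hC, hDC⟩ := hPtop_mem D hD
      exact ((h𝒟f C hC D hDC).1).trans (h𝒞A C (Finset.mem_filter.mp hC).1)
    have hPtop_open : ∀ D ∈ Ptop, ∃ U : Set (Fin n → ℝ), IsOpen U ∧ D = A ∩ U := fun D hD => by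
      obtain ⟨C, hC, hDC⟩ := hPtop_mem D hD
      exact (h𝒟f C hC D hDC).2.2
    have hPtop_cell : ∀ D ∈ Ptop, IsSACell ℝ n (e + 1) D := fun D hD => by
      obtain ⟨C, hC, hDC⟩ := hPtop_mem D hD
      exact (h𝒟f C hC D hDC).2.1
    have hPtop_disj : ∀ D ∈ Ptop, ∀ D' ∈ Ptop, D ≠ D' → Disjoint D D' := by
      intro D hD D' hD' hne
      obtain ⟨C, hC, hDC⟩ := hPtop_mem D hD
      obtain ⟨C', hC', hDC'⟩ := hPtop_mem D' hD'
      by_cases hCC : C = C'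
      · subst hCC
        exact h𝒟disj C hC D hDC D' hDC' hne
      · exact Set.disjoint_of_subset (h𝒟f C hC D hDC).1 (h𝒟f C' hC' D' hDC').1
          (hP.disjoint_of_ne (h𝒞 (Finset.mem_filter.mp hC).1) (h𝒞 (Finset.mem_filter.mp hC').1) hCC)
    -- the closed remainder
    set R : Set (Fin n → ℝ) := A \ ⋃ D ∈ Ptop, D with hR
    have hRs : IsSemialgebraic ℝ R :=
      hA.diff (IsSemialgebraic.biUnion _ _ fun D hD => (hPtop_cell D hD).isSemialgebraic)
    have hRc : IsClosed R := by
      choose! Uf hUo hUeq using hPtop_open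
      have : R = A ∩ (⋃ D ∈ Ptop, Uf D)ᶜ := by
        ext z
        simp only [hR, Set.mem_sdiff, mem_iUnion, mem_inter_iff, mem_compl_iff, exists_prop, not_exists,
          not_and]
        constructor
        · rintro ⟨hzA, hz⟩
          refine ⟨hzA, fun D hD hzU => hz D hD ?_⟩
          rw [hUeq D hD]
          exact ⟨hzA, hzU⟩
        · rintro ⟨hzA, hz⟩
          refine ⟨hzA, fun D hD hzD => hz D hD ?_⟩
          have := hUeq D hD ▸ hzD
          exact this.2
      rw [this]
      exact hAc.inter (isOpen_biUnion fun D hD => hUo D hD).isClosed_compl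
    -- the remainder has dimension `≤ e`
    have hRdim : sdim R ≤ e := by
      set Lw : Finset (Set (Fin n → ℝ)) := 𝒞.filter fun C => ¬ IsSACell ℝ n (e + 1) C with hLw
      have hRsub : R ⊆ (⋃ C ∈ 𝒞top, (C \ ⋃ D ∈ 𝒟f C, D)) ∪ ⋃ C ∈ Lw, C := by
        intro z hz
        obtain ⟨hzA, hzP⟩ := hz
        rw [← hAeq] at hzA
        obtain ⟨C, hC, hzC⟩ := mem_sUnion.mp hzA
        by_cases hcell : IsSACell ℝ n (e + 1) C
        · left
          have hCt : C ∈ 𝒞top := Finset.mem_filter.mpr ⟨hC, hcell⟩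
          refine mem_biUnion hCt ⟨hzC, fun hzD => hzP ?_⟩
          simp only [mem_iUnion, exists_prop] at hzD ⊢
          obtain ⟨D, hD, hzD⟩ := hzD
          exact ⟨D, Finset.mem_biUnion.mpr ⟨C, hCt, hD⟩, hzD⟩
        · right
          exact mem_biUnion (Finset.mem_filter.mpr ⟨hC, hcell⟩) hzC
      have h1 : ∀ C ∈ 𝒞top, sdim (C \ ⋃ D ∈ 𝒟f C, D) ≤ e := fun C hC => by
        rcases h𝒟rem C hC with h | h
        · rw [h, sdim_empty]; exact Nat.zero_le _
        · omega
      have h2 : ∀ C ∈ Lw, sdim C ≤ e := fun C hC => by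
        obtain ⟨hC𝒞, hnot⟩ := Finset.mem_filter.mp hC
        obtain ⟨d, hcell⟩ := hP.exists_isSACell C (h𝒞 hC𝒞)
        have hle : d ≤ e + 1 := hdA ▸ hcell.le_sdim_of_subset (h𝒞A C hC𝒞)
        have hne : d ≠ e + 1 := fun h => hnot (h ▸ hcell)
        rw [hcell.sdim_eq]
        omega
      have hs1 : ∀ C ∈ 𝒞top, IsSemialgebraic ℝ (C \ ⋃ D ∈ 𝒟f C, D) := fun C hC =>
        (hP.isSemialgebraic C (h𝒞 (Finset.mem_filter.mp hC).1)).diff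
          (IsSemialgebraic.biUnion _ _ fun D hD => (h𝒟f C hC D hD).2.1.isSemialgebraic)
      have hs2 : ∀ C ∈ Lw, IsSemialgebraic ℝ C := fun C hC =>
        hP.isSemialgebraic C (h𝒞 (Finset.mem_filter.mp hC).1)
      refine (sdim_mono hRsub).trans ?_
      rw [sdim_union (IsSemialgebraic.biUnion _ _ hs1) (IsSemialgebraic.biUnion _ _ hs2)]
      exact max_le (sdim_biUnion_le _ _ hs1 h1) (sdim_biUnion_le _ _ hs2 h2)
    -- stratify the remainder compatibly with `𝒜` and the frontiers of the top cells
    set 𝒜' : Finset (Set (Fin n → ℝ)) := 𝒜 ∪ Ptop.image fun D => closure D \ D with h𝒜'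
    have h𝒜' : ∀ B ∈ 𝒜', IsSemialgebraic ℝ B := by
      intro B hB
      rcases Finset.mem_union.mp hB with hB | hB
      · exact h𝒜 B hB
      · obtain ⟨D, hD, rfl⟩ := Finset.mem_image.mp hB
        exact (isSemialgebraic_closure (hPtop_cell D hD).isSemialgebraic).diff
          (hPtop_cell D hD).isSemialgebraic
    obtain ⟨𝔖', h𝔖', h𝔖'𝒜⟩ := IH hRs hRc hRdim 𝒜' h𝒜'
    obtain ⟨h𝔖'cell, h𝔖'union, h𝔖'disj, -, h𝔖'front⟩ := h𝔖'
    have h𝔖'R : ∀ S ∈ 𝔖', S ⊆ R := fun S hS => h𝔖'union ▸ subset_sUnion_of_mem hS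
    -- the stratification
    refine ⟨Ptop ∪ 𝔖', ⟨?_, ?_, ?_, ?_, ?_⟩, ?_⟩
    · intro S hS
      rcases Finset.mem_union.mp hS with hS | hS
      · exact ⟨e + 1, hPtop_cell S hS⟩
      · exact h𝔖'cell S hS
    · apply Subset.antisymm
      · intro z hz
        obtain ⟨S, hS, hzS⟩ := mem_sUnion.mp hz
        rcases Finset.mem_union.mp hS with hS | hS
        · exact hPtopA S hS hzS
        · exact (h𝔖'R S hS hzS).1
      · intro z hzA
        by_cases hz : z ∈ ⋃ D ∈ Ptop, D
        · simp only [mem_iUnion, exists_prop] at hz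
          obtain ⟨D, hD, hzD⟩ := hz
          exact mem_sUnion_of_mem hzD (Finset.mem_union_left _ hD)
        · have hzR : z ∈ R := ⟨hzA, hz⟩
          rw [← h𝔖'union] at hzR
          obtain ⟨S, hS, hzS⟩ := mem_sUnion.mp hzR
          exact mem_sUnion_of_mem hzS (Finset.mem_union_right _ hS)
    · intro S hS S' hS' hne
      rcases Finset.mem_union.mp hS with hS | hS <;> rcases Finset.mem_union.mp hS' with hS' | hS'
      · exact hPtop_disj S hS S' hS' hne
      · exact Set.disjoint_left.mpr fun z hzS hzS' => (h𝔖'R S' hS' hzS').2 (mem_biUnion hS hzS)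
      · exact Set.disjoint_left.mpr fun z hzS hzS' => (h𝔖'R S hS hzS).2 (mem_biUnion hS' hzS')
      · exact h𝔖'disj S hS S' hS' hne
    · -- frontiers lie in the closed set `A`
      intro S hS
      have hSA : S ⊆ A := by
        rcases Finset.mem_union.mp hS with hS | hS
        · exact hPtopA S hS
        · exact (h𝔖'R S hS).trans Set.sdiff_subset
      exact Set.sdiff_subset.trans (closure_minimal hSA hAc)
    · intro S hS S' hS' hmeet
      rcases Finset.mem_union.mp hS with hS | hS
      · -- frontier of a top cell: lies in `R`, is a member of `𝒜'`
        rcases Finset.mem_union.mp hS' with hS' | hS'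
        · -- another top cell cannot meet it: it is open in `A`
          exfalso
          obtain ⟨z, hzS', hzcl, hzS⟩ := hmeet
          obtain ⟨U, hU, hS'eq⟩ := hPtop_open S' hS'
          have hzU : z ∈ U := (hS'eq ▸ hzS' : z ∈ A ∩ U).2
          obtain ⟨w, hwU, hwS⟩ := mem_closure_iff.mp hzcl U hU hzU
          have hwS' : w ∈ S' := by rw [hS'eq]; exact ⟨hPtopA S hS hwS, hwU⟩
          by_cases hSS' : S = S'
          · subst hSS'
            exact hzS hzS'
          · exact Set.disjoint_left.mp (hPtop_disj S hS S' hS' hSS') hwS hwS'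
        · have hmem : closure S \ S ∈ 𝒜' :=
            Finset.mem_union_right _ (Finset.mem_image.mpr ⟨S, hS, rfl⟩)
          rcases h𝔖'𝒜 S' hS' _ hmem with h | h
          · exact h
          · exfalso
            obtain ⟨z, hzS', hz⟩ := hmeet
            exact Set.disjoint_left.mp h hzS' hz
      · -- frontier of a lower stratum: inside `R`
        have hfrR : closure S \ S ⊆ R := fun z hz =>
          (closure_minimal (h𝔖'R S hS) hRc) hz.1
        rcases Finset.mem_union.mp hS' with hS' | hS'
        · exfalso
          obtain ⟨z, hzS', hz⟩ := hmeet
          exact (hfrR hz).2 (mem_biUnion hS' hzS')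
        · exact h𝔖'front S hS S' hS' hmeet
    · intro S hS B hB
      rcases Finset.mem_union.mp hS with hS | hS
      · obtain ⟨C, hC, hSC⟩ := hPtop_mem S hS
        rcases h𝒞B C (Finset.mem_filter.mp hC).1 B hB with h | h
        · exact Or.inl ((h𝒟f C hC S hSC).1.trans h)
        · exact Or.inr (Set.disjoint_of_subset_left (h𝒟f C hC S hSC).1 h)
      · exact h𝔖'𝒜 S hS B (Finset.mem_union_left _ hB)

/-- **Existence of stratifications**, packaged form. [cite: Dries1998, Ch. 4 (1.13)] -/
theorem exists_stratification' {A : Set (Fin n → ℝ)} (hA : IsSemialgebraic ℝ A) (hAc : IsClosed A)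
    (𝒜 : Finset (Set (Fin n → ℝ))) (h𝒜 : ∀ B ∈ 𝒜, IsSemialgebraic ℝ B) :
    ∃ 𝔖 : Finset (Set (Fin n → ℝ)), IsSAStratification 𝔖 A ∧
      ∀ S ∈ 𝔖, ∀ B ∈ 𝒜, S ⊆ B ∨ Disjoint S B :=
  exists_stratification (sdim A) hA hAc le_rfl 𝒜 h𝒜

end Stratification

end Literature.ModelTheory.ExponentialFields
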